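import Mathlib
import HarnessLib
import Literature.Probability.MarkovChains.IsingSpectralHighTemperatureLSI
import Literature.Probability.MarkovChains.LogSobolevTwoPointAsymmetric
import Literature.Analysis.FunctionSpaces.UniformlyConvexLogSobolevBounded

/-!
# Proof of the spectral high-temperature log-Sobolev inequality for Ising models
# (Bauerschmidt–Bodineau 2019 = [BBD] Theorem 10): discharge of
# `SpectralIsing.BauerschmidtBodineau2019_logSobolev`

HONEST FRAMING: a functional inequality for DISCRETE ±1 spins with a quadratic interaction of spectral
high temperature (`β < 1` in the normalisation `spec(A) ⊆ [0,1]`); a sibling-setting criterion (cell ym-ir,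
census row B17).  Nothing here is a statement about gauge theories; the Yang–Mills mass gap is not touched.

We FOLLOW THE PRINTED PROOF, R. Bauerschmidt, T. Bodineau, B. Dagallier, *Stochastic dynamics and the
Polchinski equation: an introduction*, Probab. Surveys 21 (2024) = arXiv:2307.07619 [BBD], §6.4.1–§6.4.3
(pp. 37–40 of the held text), which is the proof of R. Bauerschmidt, T. Bodineau, J. Funct. Anal. 276 (2019):

1. §6.4.1 (eq: inverse covariance)–(eq_decomp_Ising_measure) at `t = 0`: the HUBBARD–STRATONOVICH
   decomposition.  With `c ∈ (β, 1)` (`c` is [BBD]'s `α`), `B = c·1 − βA` is positive definite and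
   `e^{−½β(σ,Aσ)} = e^{−½c|Λ|} e^{½(σ,Bσ)}`, and `e^{½(σ,Bσ)} ∝ ∫ e^{−½(φ,B⁻¹φ) + (φ,σ)} dφ` (complete the
   square, translation invariance).  Hence `E_μ[F] = E_ν[E_{μ^φ}[F]]` where, given the Gaussian field `φ`,
   `μ^φ` is the PRODUCT measure with fields `φ_x + h_x` ([BBD] (e:muphi), `μ_0^φ`), and the renormalised
   measure is `ν(dφ) ∝ e^{−U(φ)}dφ`, `U(φ) = ½(φ, B⁻¹φ) − Σ_x log(2cosh(φ_x + h_x))` ((e:nu-Ising) at `t = 0`;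
   our `φ` is [BBD]'s `C_0^{-1}φ = αφ`).
2. §6.4.3 (e:ent-decomp-Ising): `Ent_μ(F) = E_ν[Ent_{μ^φ}(F)] + Ent_ν(E_{μ^φ}[F])`.
3. First term ≤ `E_ν[D_{μ^φ}(√F)] = D_μ(√F)` by the product log-Sobolev inequality with `γ₀ = 2`
   (§6.4.2 Prop. 15 + tensorisation; tree: `SpectralIsing.ent_tensorFun_le_dirichletForm_flipKernel`).
4. Second term: `ν` is uniformly log-concave, `Hess U ≥ 1/c − 1 =: λ > 0` ((e:lsiht-bis):
   `γ_{0,β} ≥ α − α²` in [BBD]'s variables), so Bakry–Émery (tree: `logSobolev_of_uniformlyConvex`, through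
   `logSobolev_of_uniformlyConvex_of_bounded`) gives `Ent_ν(G) ≤ (2/λ) E_ν|∇√G|²`, `G = E_{μ^φ}[F]`; and
   EXERCISE 5: `|∇√G|² = Σ_x Cov_{μ^φ}(F,σ_x)²/(4G) ≤ D_{μ^φ}(√F)` (covariance along a single flip,
   Cauchy–Schwarz, `Var ≤ ½D` on two points).  Hence the second term is `≤ (2c/(1−c)) D_μ(√F)`.
5. (e:Ising-summary1) with `α ↓ β`: `Ent_μ(F) ≤ (1 + 2c/(1−c)) D_μ(√F)` for every `c ∈ (β,1)`, so
   `Ent_μ(F) ≤ (1 + 2β/(1−β)) D_μ(√F)` — Theorem 10.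

Deviations from the printed road, all inessential: (i) we parametrise the auxiliary field by `φ` with
precision matrix `B⁻¹` directly (no covariance decomposition `C_t`, no degenerate Gaussian — [BBD] p0038
L20–23 allows `C_0 ≠ 0`); (ii) Exercise 5's "law of total covariance" is replaced by the equivalent
one-flip identity `Cov_{μ^φ}(F,σ_x) = Σ_σ μ^φ(σ) π_x(−σ_x) σ_x (F(σ) − F(σ^x))`; (iii) the limit
`α ↓ β` is the elementary passage `c ↓ β` in a closed inequality.  The construction is carried out for
`Λ = Fin n` (§1–§8) and transported to an arbitrary finite `Λ` by relabelling (§9).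

## References
* [BauerschmidtBodineauDagallier2023] R. Bauerschmidt, T. Bodineau, B. Dagallier, Probab. Surveys 21
  (2024) = arXiv:2307.07619: §6.4.1 (p0037 L145 – p0038 L60), §6.4.2 Prop. 15 (p0038), §6.4.3 + Exercise 5
  + Theorem 10 (p0039 L1–118). READ (held text).
* [BauerschmidtBodineau2019] R. Bauerschmidt, T. Bodineau, *A very simple proof of the LSI for high
  temperature spin systems*, J. Funct. Anal. 276 (2019) 2582–2588 ([BBD]'s [MR3926125]; cited through [BBD]).
* [BakryGentilLedoux2014] D. Bakry, I. Gentil, M. Ledoux, *Analysis and Geometry of Markov Diffusion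
  Operators* (2014), Cor. 5.7.2 (tree: `logSobolev_of_uniformlyConvex`).
-/

noncomputable section

open Finset Matrix MeasureTheory Real
open scoped RealInnerProductSpace

namespace Literature.Probability.MarkovChains

namespace SpectralIsing

namespace HS

variable {n : ℕ}

/-! ## §1 The coupling matrix `B = c·1 − βA` and the precision matrix `M = B⁻¹` -/

/-- `B = c·1 − βA` ([BBD] (eq: inverse covariance) at `t = β` up to the normalisation `C_0 = α⁻¹`: here
`c` plays the role of `α`). [cite: BauerschmidtBodineauDagallier2023, §6.4.1 (eq: inverse covariance)] -/
def couplingB (A : Matrix (Fin n) (Fin n) ℝ) (β c : ℝ) : Matrix (Fin n) (Fin n) ℝ := c • 1 - β • A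

/-- The precision matrix `M = B⁻¹` of the auxiliary Gaussian field.
[cite: BauerschmidtBodineauDagallier2023, §6.4.1 (eq: inverse covariance)] -/
def precM (A : Matrix (Fin n) (Fin n) ℝ) (β c : ℝ) : Matrix (Fin n) (Fin n) ℝ := (couplingB A β c)⁻¹

section Matrices

variable {A : Matrix (Fin n) (Fin n) ℝ} {β c : ℝ}

/-- Over `ℝ`, `v ⬝ᵥ (A *ᵥ v) ≥ 0` for `A` positive semidefinite. [folklore] -/
private theorem psd_nonneg (hA : A.PosSemidef) (v : Fin n → ℝ) : 0 ≤ v ⬝ᵥ (A *ᵥ v) := by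
  have h := hA.dotProduct_mulVec_nonneg v
  rwa [star_trivial] at h

/-- The quadratic form of `B`: `v ⬝ Bv = c|v|² − β v ⬝ Av`. [cite: BauerschmidtBodineauDagallier2023, §6.4.1] -/
theorem dot_couplingB (v : Fin n → ℝ) :
    v ⬝ᵥ (couplingB A β c *ᵥ v) = c * (v ⬝ᵥ v) - β * (v ⬝ᵥ (A *ᵥ v)) := by
  unfold couplingB
  rw [sub_mulVec, smul_mulVec, smul_mulVec, one_mulVec, dotProduct_sub, dotProduct_smul, dotProduct_smul,
    smul_eq_mul, smul_eq_mul]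

/-- `B` is symmetric when `A` is. [cite: BauerschmidtBodineauDagallier2023, §6.4.1] -/
theorem couplingB_transpose (hA : A.PosSemidef) : (couplingB A β c)ᵀ = couplingB A β c := by
  have hAt : Aᵀ = A := by
    rw [← conjTranspose_eq_transpose_of_trivial]; exact hA.isHermitian
  unfold couplingB
  rw [transpose_sub, transpose_smul, transpose_smul, transpose_one, hAt]

/-- Two-sided bounds `(c − β)|v|² ≤ v ⬝ Bv ≤ c|v|²` for `0 ≤ A ≤ 1`, `β ≥ 0`.
[cite: BauerschmidtBodineauDagallier2023, §6.4.1 (p0038 L1–5)] -/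
theorem dot_couplingB_bounds (hA : A.PosSemidef) (hA1 : (1 - A).PosSemidef) (hβ : 0 ≤ β) (v : Fin n → ℝ) :
    (c - β) * (v ⬝ᵥ v) ≤ v ⬝ᵥ (couplingB A β c *ᵥ v) ∧ v ⬝ᵥ (couplingB A β c *ᵥ v) ≤ c * (v ⬝ᵥ v) := by
  rw [dot_couplingB]
  have h0 := psd_nonneg hA v
  have h1 := psd_nonneg hA1 v
  rw [sub_mulVec, one_mulVec, dotProduct_sub] at h1
  constructor <;> nlinarith

/-- `B` is positive definite for `0 ≤ β < c` and `0 ≤ A ≤ 1`. [cite: BauerschmidtBodineauDagallier2023, §6.4.1] -/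
theorem couplingB_posDef (hA : A.PosSemidef) (hA1 : (1 - A).PosSemidef) (hβ : 0 ≤ β) (hβc : β < c) :
    (couplingB A β c).PosDef := by
  refine PosDef.of_dotProduct_mulVec_pos ?_ fun v hv => ?_
  · rw [IsHermitian, conjTranspose_eq_transpose_of_trivial, couplingB_transpose hA]
  · rw [star_trivial]
    have h := (dot_couplingB_bounds (c := c) hA hA1 hβ v).1
    have hvv : 0 < v ⬝ᵥ v := by
      obtain ⟨i, hi⟩ := Function.ne_iff.1 hv
      rw [dotProduct]
      exact Finset.sum_pos' (fun i _ => mul_self_nonneg _) ⟨i, mem_univ _, mul_self_pos.2 hi⟩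
    nlinarith

variable (hA : A.PosSemidef) (hA1 : (1 - A).PosSemidef) (hβ : 0 ≤ β) (hβc : β < c)
include hA hA1 hβ hβc

/-- `det B` is a unit. [folklore] -/
private theorem isUnit_det : IsUnit (couplingB A β c).det :=
  (isUnit_iff_isUnit_det _).1 (couplingB_posDef hA hA1 hβ hβc).isUnit

/-- `M B = 1`. [cite: BauerschmidtBodineauDagallier2023, §6.4.1] -/
theorem precM_mul : precM A β c * couplingB A β c = 1 :=
  nonsing_inv_mul _ (isUnit_det hA hA1 hβ hβc)

/-- `B M = 1`. [cite: BauerschmidtBodineauDagallier2023, §6.4.1] -/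
theorem mul_precM : couplingB A β c * precM A β c = 1 :=
  mul_nonsing_inv _ (isUnit_det hA hA1 hβ hβc)

omit hA1 hβ hβc in
/-- The quadratic form of the symmetric `B` is a symmetric bilinear form. [folklore] -/
private theorem dot_couplingB_mulVec_comm (u w : Fin n → ℝ) :
    u ⬝ᵥ (couplingB A β c *ᵥ w) = w ⬝ᵥ (couplingB A β c *ᵥ u) := by
  rw [dotProduct_mulVec, ← mulVec_transpose, couplingB_transpose hA, dotProduct_comm]

omit hA1 hβ hβc in
/-- `M` is symmetric. [cite: BauerschmidtBodineauDagallier2023, §6.4.1] -/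
theorem precM_transpose : (precM A β c)ᵀ = precM A β c := by
  unfold precM
  rw [transpose_nonsing_inv, couplingB_transpose hA]

/-- `B(Mv) = v` and `M(Bv) = v`. [cite: BauerschmidtBodineauDagallier2023, §6.4.1] -/
theorem couplingB_mulVec_precM (v : Fin n → ℝ) : couplingB A β c *ᵥ (precM A β c *ᵥ v) = v := by
  rw [mulVec_mulVec, mul_precM hA hA1 hβ hβc, one_mulVec]

/-- `M(Bv) = v`. [cite: BauerschmidtBodineauDagallier2023, §6.4.1] -/
theorem precM_mulVec_couplingB (v : Fin n → ℝ) : precM A β c *ᵥ (couplingB A β c *ᵥ v) = v := by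
  rw [mulVec_mulVec, precM_mul hA hA1 hβ hβc, one_mulVec]

omit hA1 hβ hβc in
/-- Cauchy–Schwarz for the semi-inner product of the positive semidefinite `B`:
`(x ⬝ By)² ≤ (x ⬝ Bx)(y ⬝ By)`. [folklore] -/
private theorem cs_couplingB (hB : ∀ v, 0 ≤ v ⬝ᵥ (couplingB A β c *ᵥ v)) (x y : Fin n → ℝ) :
    (x ⬝ᵥ (couplingB A β c *ᵥ y)) ^ 2
      ≤ (x ⬝ᵥ (couplingB A β c *ᵥ x)) * (y ⬝ᵥ (couplingB A β c *ᵥ y)) := by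
  have hsym : ∀ u w : Fin n → ℝ, u ⬝ᵥ (couplingB A β c *ᵥ w) = w ⬝ᵥ (couplingB A β c *ᵥ u) :=
    fun u w => by rw [dotProduct_mulVec, ← mulVec_transpose, couplingB_transpose hA, dotProduct_comm]
  set B := couplingB A β c with hBdef
  -- `t ↦ (y + t x) B (y + t x) ≥ 0`
  have hq : ∀ t : ℝ, 0 ≤ (x ⬝ᵥ (B *ᵥ x)) * (t * t) + (2 * (x ⬝ᵥ (B *ᵥ y))) * t + y ⬝ᵥ (B *ᵥ y) := by
    intro t
    have h := hB (y + t • x)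
    rw [mulVec_add, mulVec_smul, dotProduct_add, add_dotProduct, add_dotProduct, dotProduct_smul,
      smul_dotProduct, smul_dotProduct, dotProduct_smul, hsym y x] at h
    simp only [smul_eq_mul] at h
    nlinarith [h]
  have hd := discrim_le_zero hq
  rw [discrim] at hd
  nlinarith [hd]

/-- `|Bv|² ≤ c · (v ⬝ Bv)` (spectrum of `B` in `[0, c]`). [cite: BauerschmidtBodineauDagallier2023, §6.4.1
(p0038 L5, spectral radius bounded by `1`)] -/
theorem normSq_couplingB_mulVec_le (v : Fin n → ℝ) :
    (couplingB A β c *ᵥ v) ⬝ᵥ (couplingB A β c *ᵥ v) ≤ c * (v ⬝ᵥ (couplingB A β c *ᵥ v)) := by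
  set B := couplingB A β c with hBdef
  have hB : ∀ w, 0 ≤ w ⬝ᵥ (B *ᵥ w) := fun w => by
    have h := (dot_couplingB_bounds (c := c) hA hA1 hβ w).1
    have : 0 ≤ w ⬝ᵥ w := by
      rw [dotProduct]; exact sum_nonneg fun i _ => mul_self_nonneg _
    nlinarith
  have h1 : v ⬝ᵥ (B *ᵥ (B *ᵥ v)) = (B *ᵥ v) ⬝ᵥ (B *ᵥ v) := by
    rw [hBdef, dot_couplingB_mulVec_comm hA v (couplingB A β c *ᵥ v), dotProduct_comm]
  have hcs := cs_couplingB (c := c) hA hB v (B *ᵥ v)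
  rw [h1] at hcs
  have h2 := (dot_couplingB_bounds (c := c) hA hA1 hβ (B *ᵥ v)).2
  -- `|Bv|⁴ ≤ (v B v) · (Bv) B (Bv) ≤ (v B v) · c |Bv|²`
  set p := (B *ᵥ v) ⬝ᵥ (B *ᵥ v) with hp
  have hp0 : 0 ≤ p := by rw [hp, dotProduct]; exact sum_nonneg fun i _ => mul_self_nonneg _
  by_cases hpz : p = 0
  · rw [hpz]; exact mul_nonneg ((hβ.trans hβc.le)) (hB v)
  · have hp' : 0 < p := lt_of_le_of_ne hp0 (Ne.symm hpz)
    have h3 : p ^ 2 ≤ (v ⬝ᵥ (B *ᵥ v)) * (c * p) :=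
      hcs.trans (mul_le_mul_of_nonneg_left h2 (hB v))
    nlinarith

/-- **`M = B⁻¹ ≥ 1/c`**: `v ⬝ Mv ≥ (1/c)|v|²` — the source of the convexity constant `1/c − 1` of the
renormalised potential ([BBD] (e:lsiht-bis): `γ_{0,β} ≥ α − α²` in the `αφ` variables).
[cite: BauerschmidtBodineauDagallier2023, §6.4.3 (e:lsiht-bis)] -/
theorem dot_precM_ge (v : Fin n → ℝ) : (v ⬝ᵥ v) / c ≤ v ⬝ᵥ (precM A β c *ᵥ v) := by
  have hc : 0 < c := hβ.trans_lt hβc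
  set w := precM A β c *ᵥ v with hw
  have hv : couplingB A β c *ᵥ w = v := by rw [hw, couplingB_mulVec_precM hA hA1 hβ hβc]
  have h := normSq_couplingB_mulVec_le (c := c) hA hA1 hβ hβc w
  rw [hv] at h
  rw [div_le_iff₀ hc]
  calc v ⬝ᵥ v ≤ c * (w ⬝ᵥ v) := h
    _ = v ⬝ᵥ w * c := by rw [dotProduct_comm, mul_comm]

end Matrices

/-! ## §2 The Gaussian weight `e^{−½(φ,Mφ)}` on `ℝ^Λ` and the Hubbard–Stratonovich identity -/

section Gaussian

/-- The quadratic form `(φ, Mφ)` of a matrix `M`, read in the coordinates of `φ ∈ ℝ^Λ`.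
[cite: BauerschmidtBodineauDagallier2023, §6.4.1 (eq:nu-Ising)] -/
def qf (M : Matrix (Fin n) (Fin n) ℝ) (φ : EuclideanSpace ℝ (Fin n)) : ℝ := φ.ofLp ⬝ᵥ (M *ᵥ φ.ofLp)

/-- The centred Gaussian weight `e^{−½(φ,Mφ)}` with precision matrix `M` (unnormalised density of
`P_{M⁻¹}`). [cite: BauerschmidtBodineauDagallier2023, §2.1 (Gaussian integration)] -/
def gaussW (M : Matrix (Fin n) (Fin n) ℝ) (φ : EuclideanSpace ℝ (Fin n)) : ℝ := Real.exp (-(1 / 2) * qf M φ)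

variable {M B : Matrix (Fin n) (Fin n) ℝ} {c : ℝ}

/-- `‖φ‖² = φ ⬝ φ` in coordinates. [folklore] -/
private theorem norm_sq_eq_dot (φ : EuclideanSpace ℝ (Fin n)) : ‖φ‖ ^ 2 = φ.ofLp ⬝ᵥ φ.ofLp := by
  rw [EuclideanSpace.real_norm_sq_eq, dotProduct]
  exact sum_congr rfl fun i _ => by rw [sq]

/-- `(φ, Mφ)` is continuous in `φ`. [folklore] -/
private theorem continuous_qf (M : Matrix (Fin n) (Fin n) ℝ) : Continuous (qf M) := by
  unfold qf
  exact (PiLp.continuous_ofLp 2 _).dotProduct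
    ((continuous_const (y := M)).matrix_mulVec (PiLp.continuous_ofLp 2 _))

/-- The Gaussian weight is continuous. [folklore] -/
private theorem continuous_gaussW (M : Matrix (Fin n) (Fin n) ℝ) : Continuous (gaussW M) :=
  Real.continuous_exp.comp (continuous_const.mul (continuous_qf M))

/-- The Gaussian weight is positive. [folklore] -/
private theorem gaussW_pos (M : Matrix (Fin n) (Fin n) ℝ) (φ : EuclideanSpace ℝ (Fin n)) : 0 < gaussW M φ :=
  Real.exp_pos _

/-- The isotropic Gaussian `e^{−b‖φ‖²}` (`b > 0`) is Lebesgue integrable on `ℝⁿ` (real form of Mathlib's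
`GaussianFourier.integrable_cexp_neg_mul_sq_norm_add`). [folklore] -/
private theorem integrable_exp_neg_mul_sq_norm {b : ℝ} (hb : 0 < b) :
    Integrable fun φ : EuclideanSpace ℝ (Fin n) => Real.exp (-b * ‖φ‖ ^ 2) := by
  have h := GaussianFourier.integrable_cexp_neg_mul_sq_norm_add (V := EuclideanSpace ℝ (Fin n))
    (b := (b : ℂ)) (by rw [Complex.ofReal_re]; exact hb) 0 0
  simp only [zero_mul, add_zero] at h
  refine h.norm.congr (Filter.Eventually.of_forall fun x => ?_)
  simp only [Complex.norm_exp]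
  congr 1
  rw [show (-(b : ℂ) * ((‖x‖ : ℂ)) ^ 2) = (((-b * ‖x‖ ^ 2 : ℝ)) : ℂ) by push_cast; ring]
  exact Complex.ofReal_re _

/-- **Integrability of the Gaussian weight** when `M ≥ 1/c > 0`: `e^{−½(φ,Mφ)} ≤ e^{−‖φ‖²/(2c)}`.
[cite: BauerschmidtBodineauDagallier2023, §2.1 (Gaussian integration)] -/
theorem integrable_gaussW (hc : 0 < c) (hM : ∀ v : Fin n → ℝ, v ⬝ᵥ v / c ≤ v ⬝ᵥ (M *ᵥ v)) :
    Integrable (gaussW M) := by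
  refine (integrable_exp_neg_mul_sq_norm (n := n) (b := 1 / (2 * c)) (by positivity)).mono'
    (continuous_gaussW M).aestronglyMeasurable (Filter.Eventually.of_forall fun φ => ?_)
  rw [Real.norm_eq_abs, abs_of_pos (gaussW_pos M φ)]
  unfold gaussW qf
  refine Real.exp_le_exp.2 ?_
  have h := hM φ.ofLp
  rw [← norm_sq_eq_dot, div_le_iff₀ hc] at h
  have : -(1 / 2) * (φ.ofLp ⬝ᵥ (M *ᵥ φ.ofLp)) * c ≤ -(1 / (2 * c)) * ‖φ‖ ^ 2 * c := by
    rw [show -(1 / (2 * c)) * ‖φ‖ ^ 2 * c = -(1 / 2) * ‖φ‖ ^ 2 by field_simp]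
    nlinarith
  exact le_of_mul_le_mul_right this hc

/-- **Completing the square**: for `M` symmetric and `M(Bv) = v`,
`−½(φ,Mφ) + (φ,v) = −½(φ − Bv, M(φ − Bv)) + ½(v,Bv)`.
[cite: BauerschmidtBodineauDagallier2023, §6.4.1 (p0038 L8–16)] -/
theorem qf_complete_square (hMt : Mᵀ = M) (hMB : ∀ v : Fin n → ℝ, M *ᵥ (B *ᵥ v) = v)
    (φ : EuclideanSpace ℝ (Fin n)) (v : Fin n → ℝ) :
    -(1 / 2) * qf M φ + φ.ofLp ⬝ᵥ v
      = -(1 / 2) * qf M (φ - WithLp.toLp 2 (B *ᵥ v)) + (1 / 2) * (v ⬝ᵥ (B *ᵥ v)) := by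
  unfold qf
  rw [WithLp.ofLp_sub, WithLp.ofLp_toLp]
  set x := φ.ofLp with hx
  set w := B *ᵥ v with hw
  have h1 : w ⬝ᵥ (M *ᵥ x) = x ⬝ᵥ v := by
    rw [dotProduct_mulVec, ← mulVec_transpose, hMt, hw, hMB, dotProduct_comm]
  have h2 : x ⬝ᵥ (M *ᵥ w) = x ⬝ᵥ v := by rw [hw, hMB]
  have h3 : w ⬝ᵥ (M *ᵥ w) = v ⬝ᵥ (B *ᵥ v) := by rw [hw, hMB, dotProduct_comm]
  rw [mulVec_sub, dotProduct_sub, sub_dotProduct, sub_dotProduct, h1, h2, h3]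
  ring

/-- **The Hubbard–Stratonovich identity**: `∫ e^{−½(φ,Mφ) + (φ,v)} dφ = (∫ e^{−½(φ,Mφ)} dφ) · e^{½(v,Bv)}`
(`B = M⁻¹`; translation invariance of Lebesgue measure). [cite: BauerschmidtBodineauDagallier2023, §6.4.1
(p0038 L8–16: "the Ising model at inverse temperature `β` can be written as …")] -/
theorem integral_gaussW_linear (hMt : Mᵀ = M) (hMB : ∀ v : Fin n → ℝ, M *ᵥ (B *ᵥ v) = v)
    (v : Fin n → ℝ) :
    ∫ φ, Real.exp (-(1 / 2) * qf M φ + φ.ofLp ⬝ᵥ v)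
      = (∫ φ, gaussW M φ) * Real.exp ((1 / 2) * (v ⬝ᵥ (B *ᵥ v))) := by
  have e : ∀ φ : EuclideanSpace ℝ (Fin n), Real.exp (-(1 / 2) * qf M φ + φ.ofLp ⬝ᵥ v)
      = gaussW M (φ - WithLp.toLp 2 (B *ᵥ v)) * Real.exp ((1 / 2) * (v ⬝ᵥ (B *ᵥ v))) := by
    intro φ
    rw [qf_complete_square hMt hMB, Real.exp_add]
    rfl
  simp_rw [e]
  rw [integral_mul_const, integral_sub_right_eq_self (gaussW M) (WithLp.toLp 2 (B *ᵥ v))]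

/-- Integrability of `φ ↦ e^{−½(φ,Mφ) + (φ,v)}`. [cite: BauerschmidtBodineauDagallier2023, §6.4.1] -/
theorem integrable_gaussW_linear (hint : Integrable (gaussW M)) (hMt : Mᵀ = M)
    (hMB : ∀ v : Fin n → ℝ, M *ᵥ (B *ᵥ v) = v) (v : Fin n → ℝ) :
    Integrable fun φ : EuclideanSpace ℝ (Fin n) => Real.exp (-(1 / 2) * qf M φ + φ.ofLp ⬝ᵥ v) := by
  have e : (fun φ : EuclideanSpace ℝ (Fin n) => Real.exp (-(1 / 2) * qf M φ + φ.ofLp ⬝ᵥ v))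
      = fun φ => gaussW M (φ - WithLp.toLp 2 (B *ᵥ v)) * Real.exp ((1 / 2) * (v ⬝ᵥ (B *ᵥ v))) := by
    funext φ
    rw [qf_complete_square hMt hMB, Real.exp_add]
    rfl
  rw [e]
  exact (hint.comp_sub_right _).mul_const _

/-- The Gaussian normalisation `∫ e^{−½(φ,Mφ)} dφ` is positive. [folklore] -/
private theorem integral_gaussW_pos (hint : Integrable (gaussW M)) : 0 < ∫ φ, gaussW M φ := by
  unfold gaussW at hint ⊢
  exact integral_exp_pos hint

end Gaussian

/-! ## §3 Spins, the product (infinite-temperature) laws `μ_0^φ`, and the joint Hubbard–Stratonovich weight -/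

section Weights

/-- The spin configuration as a real vector, `(σ_x)_x ∈ {±1}^Λ ⊂ ℝ^Λ`.
[cite: BauerschmidtBodineauDagallier2023, §6.4.1 (eq: Ising model-bis)] -/
def sv (σ : Fin n → ℤˣ) : Fin n → ℝ := fun i => spin σ i

/-- `Σ_{u ∈ ℤˣ} f(u) = f(1) + f(−1)`. [folklore] -/
private theorem sum_units (f : ℤˣ → ℝ) : ∑ u, f u = f 1 + f (-1) := by
  have : (univ : Finset ℤˣ) = {1, -1} := by decide
  rw [this, Finset.sum_pair (by decide)]

/-- `σ_x² = 1`. [folklore] -/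
private theorem sv_mul_self (σ : Fin n → ℤˣ) (i : Fin n) : sv σ i * sv σ i = 1 := by
  unfold sv spin
  rcases Int.units_eq_one_or (σ i) with h | h <;> simp [h]

/-- `(σ, σ) = |Λ|`. [cite: BauerschmidtBodineauDagallier2023, §6.4.1 (p0038 L1: "since `σ_x² = 1` for each `x`")] -/
theorem sv_dot_self (σ : Fin n → ℤˣ) : sv σ ⬝ᵥ sv σ = n := by
  unfold dotProduct
  simp_rw [sv_mul_self]
  simp

/-- `|σ_x| ≤ 1`. [folklore] -/
private theorem abs_sv_le (σ : Fin n → ℤˣ) (i : Fin n) : |sv σ i| ≤ 1 := by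
  unfold sv spin
  rcases Int.units_eq_one_or (σ i) with h | h <;> simp [h]

/-- The spin at `x` flips sign under `σ ↦ σ^x` and is unchanged at the other sites. [folklore] -/
private theorem sv_flip (x : Fin n) (σ : Fin n → ℤˣ) (i : Fin n) :
    sv (flip x σ) i = if i = x then -sv σ i else sv σ i := by
  unfold sv spin
  rw [flip_apply]
  split_ifs with h
  · subst h; push_cast [Units.val_neg]; ring
  · rfl

/-- The single-site law in the field `u`: `π_u(s) = e^{us}/(e^u + e^{−u})` on `{±1}` — the factor of the
product measure `μ_0^φ` with external field `u = φ_x + h_x`.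
[cite: BauerschmidtBodineauDagallier2023, §6.4.1 (e:muphi) at `t = 0`] -/
def bw (u : ℝ) (s : ℤˣ) : ℝ := Real.exp (u * ((s : ℤ) : ℝ)) / (Real.exp u + Real.exp (-u))

/-- `π_u > 0`. [folklore] -/
private theorem bw_pos (u : ℝ) (s : ℤˣ) : 0 < bw u s := by unfold bw; positivity

/-- `π_u(+1) + π_u(−1) = 1`. [folklore] -/
private theorem sum_bw (u : ℝ) : ∑ s, bw u s = 1 := by
  rw [sum_units]
  unfold bw
  have h : 0 < Real.exp u + Real.exp (-u) := by positivity
  field_simp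
  push_cast
  ring_nf

/-- The site laws `(π_{u_x})_{x ∈ Λ}` of the product measure with fields `u`.
[cite: BauerschmidtBodineauDagallier2023, §6.4.1 (e:muphi)] -/
def siteLaw (u : Fin n → ℝ) : Fin n → ℤˣ → ℝ := fun j s => bw (u j) s

/-- **The fluctuation measure `μ_0^φ`**: the PRODUCT measure on `{±1}^Λ` with fields `φ_x + h_x`
([BBD] (e:muphi) at `t = 0`, "an infinite temperature Ising measure `μ_0^φ` with external field
`C_0^{-1}φ + h`"). [cite: BauerschmidtBodineauDagallier2023, §6.4.1 (e:muphi), §6.4.3 (p0038 L137–140)] -/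
def condLaw (h : Fin n → ℝ) (φ : EuclideanSpace ℝ (Fin n)) : (Fin n → ℤˣ) → ℝ :=
  tensorFun (siteLaw (φ.ofLp + h))

/-- `μ_0^φ > 0`. [folklore] -/
private theorem condLaw_pos (h : Fin n → ℝ) (φ : EuclideanSpace ℝ (Fin n)) (σ : Fin n → ℤˣ) :
    0 < condLaw h φ σ :=
  tensorFun_pos (fun _ u => bw_pos _ u) σ

/-- `Σ_σ μ_0^φ(σ) = 1`. [folklore] -/
private theorem sum_condLaw (h : Fin n → ℝ) (φ : EuclideanSpace ℝ (Fin n)) : ∑ σ, condLaw h φ σ = 1 :=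
  sum_tensorFun_eq_one _ fun _ => sum_bw _

/-- `Σ_σ e^{(u,σ)} = Π_x (e^{u_x} + e^{−u_x})` (the product partition function).
[cite: BauerschmidtBodineauDagallier2023, §6.4.2 ("by tensorisation")] -/
theorem sum_exp_dot_sv (u : Fin n → ℝ) :
    ∑ σ : Fin n → ℤˣ, Real.exp (u ⬝ᵥ sv σ) = ∏ j, (Real.exp (u j) + Real.exp (-(u j))) := by
  have h : ∀ σ : Fin n → ℤˣ, Real.exp (u ⬝ᵥ sv σ) = ∏ j, Real.exp (u j * (((σ j : ℤ)) : ℝ)) := by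
    intro σ
    rw [dotProduct, Real.exp_sum]
    rfl
  simp_rw [h]
  rw [← Fintype.prod_sum (fun j (s : ℤˣ) => Real.exp (u j * ((s : ℤ) : ℝ)))]
  refine prod_congr rfl fun j _ => ?_
  rw [sum_units]
  push_cast
  ring_nf

/-- `μ_0^φ(σ) = e^{(φ + h, σ)} / Π_x (e^{φ_x+h_x} + e^{−φ_x−h_x})` — the product measure in Gibbs form.
[cite: BauerschmidtBodineauDagallier2023, §6.4.1 (e:muphi)] -/
theorem condLaw_eq (h : Fin n → ℝ) (φ : EuclideanSpace ℝ (Fin n)) (σ : Fin n → ℤˣ) :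
    condLaw h φ σ = Real.exp ((φ.ofLp + h) ⬝ᵥ sv σ)
      / ∏ j, (Real.exp ((φ.ofLp + h) j) + Real.exp (-((φ.ofLp + h) j))) := by
  unfold condLaw tensorFun siteLaw bw
  rw [prod_div_distrib, dotProduct, Real.exp_sum]
  rfl

/-- **The joint Hubbard–Stratonovich weight** `J(σ, φ) = e^{−½(φ,Mφ) + (φ,σ) + (h,σ)}` on
`{±1}^Λ × ℝ^Λ`. [cite: BauerschmidtBodineauDagallier2023, §6.4.1 (eq_decomp_Ising_measure)] -/
def jointW (M : Matrix (Fin n) (Fin n) ℝ) (h : Fin n → ℝ) (σ : Fin n → ℤˣ)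
    (φ : EuclideanSpace ℝ (Fin n)) : ℝ :=
  Real.exp (-(1 / 2) * qf M φ + φ.ofLp ⬝ᵥ sv σ + h ⬝ᵥ sv σ)

/-- The `φ`-density `D(φ) = Σ_σ J(σ,φ)` of the renormalised measure (unnormalised).
[cite: BauerschmidtBodineauDagallier2023, §6.4.1 (e:nu-Ising)] -/
def fieldDens (M : Matrix (Fin n) (Fin n) ℝ) (h : Fin n → ℝ) (φ : EuclideanSpace ℝ (Fin n)) : ℝ :=
  ∑ σ, jointW M h σ φ

variable {M : Matrix (Fin n) (Fin n) ℝ} {h : Fin n → ℝ}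

/-- `J(σ,φ) = e^{−½(φ,Mφ)} e^{(φ+h,σ)}`. [folklore] -/
private theorem jointW_eq (σ : Fin n → ℤˣ) (φ : EuclideanSpace ℝ (Fin n)) :
    jointW M h σ φ = gaussW M φ * Real.exp ((φ.ofLp + h) ⬝ᵥ sv σ) := by
  unfold jointW gaussW
  rw [← Real.exp_add, add_dotProduct]
  ring_nf

/-- `J > 0`. [folklore] -/
private theorem jointW_pos (σ : Fin n → ℤˣ) (φ : EuclideanSpace ℝ (Fin n)) : 0 < jointW M h σ φ := Real.exp_pos _

/-- `D(φ) = e^{−½(φ,Mφ)} Π_x (e^{φ_x+h_x} + e^{−φ_x−h_x})`. [cite: BauerschmidtBodineauDagallier2023, §6.4.1 (e:nu-Ising)] -/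
theorem fieldDens_eq (φ : EuclideanSpace ℝ (Fin n)) :
    fieldDens M h φ = gaussW M φ * ∏ j, (Real.exp ((φ.ofLp + h) j) + Real.exp (-((φ.ofLp + h) j))) := by
  unfold fieldDens
  simp_rw [jointW_eq]
  rw [← mul_sum, sum_exp_dot_sv]

/-- `D > 0`. [folklore] -/
private theorem fieldDens_pos (φ : EuclideanSpace ℝ (Fin n)) : 0 < fieldDens M h φ := by
  rw [fieldDens_eq]
  exact mul_pos (gaussW_pos M φ) (prod_pos fun j _ => by positivity)

/-- `μ_0^φ(σ) · D(φ) = J(σ,φ)` — the conditional law given the field is the product measure.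
[cite: BauerschmidtBodineauDagallier2023, §6.4.1 (eq_decomp_Ising_measure)–(e:muphi)] -/
theorem condLaw_mul_fieldDens (σ : Fin n → ℤˣ) (φ : EuclideanSpace ℝ (Fin n)) :
    condLaw h φ σ * fieldDens M h φ = jointW M h σ φ := by
  rw [condLaw_eq, fieldDens_eq, jointW_eq]
  have hP : 0 < ∏ j, (Real.exp ((φ.ofLp + h) j) + Real.exp (-((φ.ofLp + h) j))) :=
    prod_pos fun j _ => by positivity
  field_simp

/-- `D` is continuous. [folklore] -/
private theorem continuous_fieldDens : Continuous (fieldDens M h) := by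
  unfold fieldDens jointW
  refine continuous_finsetSum _ fun σ _ => Real.continuous_exp.comp ?_
  refine ((continuous_const.mul (continuous_qf M)).add ?_).add continuous_const
  exact (PiLp.continuous_ofLp 2 _).dotProduct continuous_const

end Weights

/-! ## §4 The `σ`-marginal is the Ising law: `E_μ[F] = E_ν[E_{μ_0^φ}[F]]` -/

section Marginal

variable {A : Matrix (Fin n) (Fin n) ℝ} {h : Fin n → ℝ} {β c : ℝ}
variable (hA : A.PosSemidef) (hA1 : (1 - A).PosSemidef) (hβ : 0 ≤ β) (hβc : β < c)
include hA hA1 hβ hβc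

/-- The Gaussian weight of the precision matrix `M = (c·1 − βA)⁻¹` is integrable.
[cite: BauerschmidtBodineauDagallier2023, §6.4.1] -/
theorem integrable_gaussW_precM : Integrable (gaussW (precM A β c)) :=
  integrable_gaussW (hβ.trans_lt hβc) (dot_precM_ge hA hA1 hβ hβc)

/-- `J(σ, ·)` is integrable. [cite: BauerschmidtBodineauDagallier2023, §6.4.1] -/
theorem integrable_jointW (σ : Fin n → ℤˣ) : Integrable (jointW (precM A β c) h σ) := by
  have hint := integrable_gaussW_linear (integrable_gaussW_precM hA hA1 hβ hβc)
    (precM_transpose hA) (precM_mulVec_couplingB hA hA1 hβ hβc) (sv σ)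
  refine (hint.mul_const (Real.exp (h ⬝ᵥ sv σ))).congr (Filter.Eventually.of_forall fun φ => ?_)
  show Real.exp _ * Real.exp _ = Real.exp _
  rw [← Real.exp_add]

/-- `D` is integrable. [cite: BauerschmidtBodineauDagallier2023, §6.4.1] -/
theorem integrable_fieldDens : Integrable (fieldDens (precM A β c) h) := by
  have : fieldDens (precM A β c) h = fun φ => ∑ σ, jointW (precM A β c) h σ φ := rfl
  rw [this]
  exact integrable_finsetSum _ fun σ _ => integrable_jointW hA hA1 hβ hβc σ

/-- **The `σ`-marginal of the joint weight is the Ising weight**: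
`∫ J(σ,φ) dφ = Z_G · e^{c|Λ|/2} · e^{−½β(σ,Aσ) + (h,σ)}` (`Z_G = ∫ e^{−½(φ,Mφ)}`), by the
Hubbard–Stratonovich identity and `½(σ,Bσ) = ½c|Λ| − ½β(σ,Aσ)`.
[cite: BauerschmidtBodineauDagallier2023, §6.4.1 (p0038 L1–16, (eq_decomp_Ising_measure))] -/
theorem integral_jointW (σ : Fin n → ℤˣ) :
    ∫ φ, jointW (precM A β c) h σ φ
      = (∫ φ, gaussW (precM A β c) φ) * Real.exp (c * n / 2) * weight A h β σ := by
  have e1 : ∀ φ : EuclideanSpace ℝ (Fin n), jointW (precM A β c) h σ φ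
      = Real.exp (-(1 / 2) * qf (precM A β c) φ + φ.ofLp ⬝ᵥ sv σ) * Real.exp (h ⬝ᵥ sv σ) := by
    intro φ; unfold jointW; rw [← Real.exp_add]
  simp_rw [e1]
  rw [integral_mul_const, integral_gaussW_linear (precM_transpose hA)
    (precM_mulVec_couplingB hA hA1 hβ hβc) (sv σ), dot_couplingB, sv_dot_self]
  have e2 : sv σ ⬝ᵥ (A *ᵥ sv σ) = ∑ x, ∑ y, spin σ x * A x y * spin σ y := by
    simp only [dotProduct, mulVec, sv, Finset.mul_sum]
    exact sum_congr rfl fun x _ => sum_congr rfl fun y _ => by ring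
  have e3 : h ⬝ᵥ sv σ = ∑ x, h x * spin σ x := rfl
  rw [e2, e3]
  unfold weight
  rw [mul_assoc, mul_assoc, ← Real.exp_add, ← Real.exp_add]
  congr 2
  ring

/-- `∫ D = Z_G e^{c|Λ|/2} · Z` with the Ising partition function `Z`.
[cite: BauerschmidtBodineauDagallier2023, §6.4.1] -/
theorem integral_fieldDens :
    ∫ φ, fieldDens (precM A β c) h φ
      = (∫ φ, gaussW (precM A β c) φ) * Real.exp (c * n / 2) * Z A h β := by
  have : fieldDens (precM A β c) h = fun φ => ∑ σ, jointW (precM A β c) h σ φ := rfl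
  rw [this, integral_finsetSum _ fun σ _ => integrable_jointW hA hA1 hβ hβc σ]
  simp_rw [integral_jointW hA hA1 hβ hβc]
  unfold Z
  rw [mul_sum]

/-- `∫ D > 0`. [folklore] -/
private theorem integral_fieldDens_pos : 0 < ∫ φ, fieldDens (precM A β c) h φ := by
  rw [integral_fieldDens hA hA1 hβ hβc]
  exact mul_pos (mul_pos (integral_gaussW_pos (integrable_gaussW_precM hA hA1 hβ hβc))
    (Real.exp_pos _)) (Z_pos A h β)

end Marginal

/-! ## §5 The renormalised measure `ν` and the decomposition `E_μ[F] = E_ν[E_{μ_0^φ}[F]]` -/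

section Mixture

/-- **The renormalised potential** `U(φ) = ½(φ,Mφ) − Σ_x log(e^{φ_x+h_x} + e^{−φ_x−h_x})`, i.e. [BBD]'s
`½(φ,(C_β − C_0)^{-1}φ) + V_0(φ)` at `t = 0` in the variables `C_0^{-1}φ` (up to an additive constant).
[cite: BauerschmidtBodineauDagallier2023, §6.4.1 (eq_def_V_ising), (e:nu-Ising)] -/
def fieldPot (M : Matrix (Fin n) (Fin n) ℝ) (h : Fin n → ℝ) (φ : EuclideanSpace ℝ (Fin n)) : ℝ :=
  (1 / 2) * qf M φ - ∑ j, Real.log (Real.exp ((φ.ofLp + h) j) + Real.exp (-((φ.ofLp + h) j)))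

/-- **The renormalised measure** `ν = ν_{0,β}`: `ν(dφ) ∝ e^{−U(φ)} dφ` on `ℝ^Λ`.
[cite: BauerschmidtBodineauDagallier2023, §6.4.1 (e:nu-Ising)] -/
def fieldLaw (M : Matrix (Fin n) (Fin n) ℝ) (h : Fin n → ℝ) : Measure (EuclideanSpace ℝ (Fin n)) :=
  volume.tilted fun φ => -fieldPot M h φ

/-- `G(φ) = E_{μ_0^φ}[F] = Σ_σ μ_0^φ(σ) F(σ)` — the conditional expectation given the field.
[cite: BauerschmidtBodineauDagallier2023, §6.4.3 (e:ent-decomp-Ising)] -/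
def condMean (h : Fin n → ℝ) (F : (Fin n → ℤˣ) → ℝ) (φ : EuclideanSpace ℝ (Fin n)) : ℝ :=
  ∑ σ, condLaw h φ σ * F σ

variable {M : Matrix (Fin n) (Fin n) ℝ} {h : Fin n → ℝ}

/-- `e^{−U} = D`. [cite: BauerschmidtBodineauDagallier2023, §6.4.1 (e:nu-Ising)] -/
theorem exp_neg_fieldPot (φ : EuclideanSpace ℝ (Fin n)) : Real.exp (-fieldPot M h φ) = fieldDens M h φ := by
  rw [fieldDens_eq]
  unfold fieldPot gaussW
  rw [neg_sub, sub_eq_add_neg, Real.exp_add, Real.exp_sum, mul_comm]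
  congr 1
  · congr 1; ring
  · exact prod_congr rfl fun j _ => Real.exp_log (add_pos (Real.exp_pos _) (Real.exp_pos _))

/-- `U` is continuous. [folklore] -/
private theorem continuous_fieldPot : Continuous (fieldPot M h) := by
  unfold fieldPot
  refine (continuous_const.mul (continuous_qf M)).sub (continuous_finsetSum _ fun j _ => ?_)
  have hj : Continuous fun φ : EuclideanSpace ℝ (Fin n) => (φ.ofLp + h) j :=
    ((PiLp.continuous_apply 2 _ j).add continuous_const)
  exact (((Real.continuous_exp.comp hj).add (Real.continuous_exp.comp hj.neg)).log
    fun φ => (add_pos (Real.exp_pos _) (Real.exp_pos _)).ne')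

/-- `∫ g dν = (∫ D g)/(∫ D)`. [cite: BauerschmidtBodineauDagallier2023, §6.4.1 (e:nu-Ising)] -/
theorem integral_fieldLaw (g : EuclideanSpace ℝ (Fin n) → ℝ) :
    ∫ φ, g φ ∂(fieldLaw M h) = (∫ φ, fieldDens M h φ * g φ) / ∫ φ, fieldDens M h φ := by
  unfold fieldLaw
  rw [integral_tilted]
  simp_rw [exp_neg_fieldPot, smul_eq_mul, div_mul_eq_mul_div]
  rw [integral_div]

/-- `μ_0^φ(σ)` is continuous in `φ`. [folklore] -/
private theorem continuous_condLaw (σ : Fin n → ℤˣ) : Continuous fun φ : EuclideanSpace ℝ (Fin n) => condLaw h φ σ := by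
  unfold condLaw tensorFun siteLaw bw
  refine continuous_finsetProd _ fun j _ => ?_
  have hj : Continuous fun φ : EuclideanSpace ℝ (Fin n) => (φ.ofLp + h) j :=
    ((PiLp.continuous_apply 2 _ j).add continuous_const)
  exact (Real.continuous_exp.comp (hj.mul continuous_const)).div
    ((Real.continuous_exp.comp hj).add (Real.continuous_exp.comp hj.neg))
    fun φ => (add_pos (Real.exp_pos _) (Real.exp_pos _)).ne'

/-- `μ_0^φ(σ) ≤ 1`. [folklore] -/
private theorem condLaw_le_one (φ : EuclideanSpace ℝ (Fin n)) (σ : Fin n → ℤˣ) : condLaw h φ σ ≤ 1 := by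
  rw [← sum_condLaw h φ]
  exact single_le_sum (f := fun τ => condLaw h φ τ) (fun τ _ => (condLaw_pos h φ τ).le) (mem_univ σ)

/-- `φ ↦ Σ_σ μ_0^φ(σ) W(σ)` is continuous and bounded by `Σ_σ |W(σ)|`. [folklore] -/
private theorem continuous_sum_condLaw_mul (W : (Fin n → ℤˣ) → ℝ) :
    Continuous fun φ : EuclideanSpace ℝ (Fin n) => ∑ σ, condLaw h φ σ * W σ :=
  continuous_finsetSum _ fun σ _ => (continuous_condLaw σ).mul continuous_const

/-- `|Σ_σ μ_0^φ(σ) W(σ)| ≤ Σ_σ |W(σ)|`. [folklore] -/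
private theorem abs_sum_condLaw_mul_le (W : (Fin n → ℤˣ) → ℝ) (φ : EuclideanSpace ℝ (Fin n)) :
    |∑ σ, condLaw h φ σ * W σ| ≤ ∑ σ, |W σ| := by
  refine (abs_sum_le_sum_abs _ _).trans (sum_le_sum fun σ _ => ?_)
  rw [abs_mul, abs_of_pos (condLaw_pos h φ σ)]
  exact mul_le_of_le_one_left (abs_nonneg _) (condLaw_le_one φ σ)

/-- Bounded continuous functions are `ν`-integrable (`ν` finite). [folklore] -/
private theorem integrable_fieldLaw_of_bounded [IsFiniteMeasure (fieldLaw M h)] {g : EuclideanSpace ℝ (Fin n) → ℝ}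
    (hg : Continuous g) (C : ℝ) (hC : ∀ φ, |g φ| ≤ C) : Integrable g (fieldLaw M h) :=
  Literature.Analysis.FunctionSpaces.integrable_of_norm_le_const hg.aestronglyMeasurable C
    fun φ => by rw [Real.norm_eq_abs]; exact hC φ

variable {A : Matrix (Fin n) (Fin n) ℝ} {β c : ℝ}
variable (hA : A.PosSemidef) (hA1 : (1 - A).PosSemidef) (hβ : 0 ≤ β) (hβc : β < c)
include hA hA1 hβ hβc

/-- `ν` is a probability measure. [cite: BauerschmidtBodineauDagallier2023, §6.4.1 (e:nu-Ising)] -/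
theorem isProbabilityMeasure_fieldLaw : IsProbabilityMeasure (fieldLaw (precM A β c) h) := by
  unfold fieldLaw
  refine isProbabilityMeasure_tilted ?_
  simp_rw [exp_neg_fieldPot]
  exact integrable_fieldDens hA hA1 hβ hβc

/-- **The decomposition `E_μ[W] = E_ν[E_{μ_0^φ}[W]]`** ([BBD] (eq_decomp_Ising_measure) at `t = 0`):
for every `W : {±1}^Λ → ℝ`, `Σ_σ μ(σ)W(σ) = ∫ (Σ_σ μ_0^φ(σ)W(σ)) ν(dφ)` with the Ising law
`μ = SpectralIsing.law A h β`. [cite: BauerschmidtBodineauDagallier2023, §6.4.1 (eq_decomp_Ising_measure)] -/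
theorem sum_law_mul (W : (Fin n → ℤˣ) → ℝ) :
    ∑ σ, law A h β σ * W σ = ∫ φ, (∑ σ, condLaw h φ σ * W σ) ∂(fieldLaw (precM A β c) h) := by
  rw [integral_fieldLaw]
  have e : ∀ φ : EuclideanSpace ℝ (Fin n), fieldDens (precM A β c) h φ * ∑ σ, condLaw h φ σ * W σ
      = ∑ σ, jointW (precM A β c) h σ φ * W σ := by
    intro φ
    rw [mul_sum]
    refine sum_congr rfl fun σ _ => ?_
    rw [← mul_assoc, mul_comm (fieldDens _ _ _), condLaw_mul_fieldDens]
  simp_rw [e]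
  rw [integral_finsetSum _ (fun σ _ => (integrable_jointW hA hA1 hβ hβc σ).mul_const _)]
  simp_rw [integral_mul_const, integral_jointW hA hA1 hβ hβc, integral_fieldDens hA hA1 hβ hβc]
  have hZg := integral_gaussW_pos (integrable_gaussW_precM hA hA1 hβ hβc)
  have hZ := Z_pos A h β
  have hE := Real.exp_pos (c * n / 2)
  rw [sum_div]
  refine sum_congr rfl fun σ _ => ?_
  unfold law
  field_simp

/-- **The Dirichlet form decomposes along the mixture**: `D_μ(g) = E_ν[D_{μ_0^φ}(g)]` for the standard
single-flip Dirichlet form ("The last equality relies on the specific jump rates in the standard Dirichlet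
form"). [cite: BauerschmidtBodineauDagallier2023, §6.4.3 (e:Ising-firstterm)] -/
theorem dirichletForm_law_eq_integral (g : (Fin n → ℤˣ) → ℝ) :
    dirichletForm (law A h β) flipKernel g
      = ∫ φ, dirichletForm (condLaw h φ) flipKernel g ∂(fieldLaw (precM A β c) h) := by
  simp_rw [dirichletForm_flipKernel, mul_sum, ← mul_assoc, mul_comm (1 / 2 : ℝ), mul_assoc, ← mul_sum]
  exact sum_law_mul hA hA1 hβ hβc _

/-- **The entropy decomposition** ([BBD] (e:ent-decomp-Ising)):
`Ent_μ(F) = E_ν[Ent_{μ_0^φ}(F)] + Ent_ν(E_{μ_0^φ}[F])`, the second entropy written out as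
`∫ G log G dν − (∫ G dν) log ∫ G dν`, `G = E_{μ_0^φ}[F]`.
[cite: BauerschmidtBodineauDagallier2023, §6.4.3 (e:ent-decomp-Ising)] -/
theorem ent_law_eq (F : (Fin n → ℤˣ) → ℝ) :
    ent (law A h β) F
      = (∫ φ, ent (condLaw h φ) F ∂(fieldLaw (precM A β c) h))
        + ((∫ φ, condMean h F φ * Real.log (condMean h F φ) ∂(fieldLaw (precM A β c) h))
          - (∫ φ, condMean h F φ ∂(fieldLaw (precM A β c) h))
            * Real.log (∫ φ, condMean h F φ ∂(fieldLaw (precM A β c) h))) := by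
  haveI := isProbabilityMeasure_fieldLaw (h := h) hA hA1 hβ hβc
  unfold ent
  rw [sum_law_mul hA hA1 hβ hβc (fun σ => F σ * Real.log (F σ)), sum_law_mul hA hA1 hβ hβc F]
  have e : ∀ φ : EuclideanSpace ℝ (Fin n), ∑ σ, condLaw h φ σ * (F σ * Real.log (F σ))
      = ((∑ σ, condLaw h φ σ * (F σ * Real.log (F σ))) - condMean h F φ * Real.log (condMean h F φ))
        + condMean h F φ * Real.log (condMean h F φ) := fun φ => by ring
  rw [integral_congr_ae (Filter.Eventually.of_forall e)]
  -- integrability of the two pieces (bounded continuous functions)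
  obtain ⟨K, hK⟩ := (isCompact_Icc : IsCompact (Set.Icc (-∑ σ, |F σ|) (∑ σ, |F σ|))).exists_bound_of_continuousOn
    (Real.continuous_mul_log.continuousOn)
  have hGc : Continuous (condMean h F) := continuous_sum_condLaw_mul F
  have hGlog : Integrable (fun φ => condMean h F φ * Real.log (condMean h F φ)) (fieldLaw (precM A β c) h) := by
    refine integrable_fieldLaw_of_bounded (by exact Real.continuous_mul_log.comp hGc) K fun φ => ?_
    have hb := abs_le.1 (abs_sum_condLaw_mul_le (h := h) F φ)
    simpa [Real.norm_eq_abs] using hK (condMean h F φ) ⟨hb.1, hb.2⟩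
  have h1 : Integrable (fun φ => (∑ σ, condLaw h φ σ * (F σ * Real.log (F σ)))
      - condMean h F φ * Real.log (condMean h F φ)) (fieldLaw (precM A β c) h) :=
    (integrable_fieldLaw_of_bounded (continuous_sum_condLaw_mul _) _ (abs_sum_condLaw_mul_le _)).sub hGlog
  rw [integral_add h1 hGlog]
  unfold condMean
  ring

end Mixture

/-! ## §6 The first term: `E_ν[Ent_{μ_0^φ}(F)] ≤ E_ν[D_{μ_0^φ}(√F)] = D_μ(√F)` (Prop. 15 + tensorisation) -/

section FirstTerm

variable {M : Matrix (Fin n) (Fin n) ℝ} {h : Fin n → ℝ}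

/-- `φ ↦ Ent_{μ_0^φ}(F)` is `ν`-integrable. [folklore] -/
private theorem integrable_ent_condLaw [IsFiniteMeasure (fieldLaw M h)] (F : (Fin n → ℤˣ) → ℝ) :
    Integrable (fun φ => ent (condLaw h φ) F) (fieldLaw M h) := by
  obtain ⟨K, hK⟩ := (isCompact_Icc : IsCompact (Set.Icc (-∑ σ, |F σ|) (∑ σ, |F σ|))).exists_bound_of_continuousOn
    (Real.continuous_mul_log.continuousOn)
  have hGc : Continuous (condMean h F) := continuous_sum_condLaw_mul F
  have h2 : Integrable (fun φ => condMean h F φ * Real.log (condMean h F φ)) (fieldLaw M h) := by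
    refine integrable_fieldLaw_of_bounded (by exact Real.continuous_mul_log.comp hGc) K fun φ => ?_
    have hb := abs_le.1 (abs_sum_condLaw_mul_le (h := h) F φ)
    simpa [Real.norm_eq_abs] using hK (condMean h F φ) ⟨hb.1, hb.2⟩
  have h1 := integrable_fieldLaw_of_bounded (M := M) (h := h) (continuous_sum_condLaw_mul (h := h) _) _
    (abs_sum_condLaw_mul_le (fun σ => F σ * Real.log (F σ)))
  exact (h1.sub h2).congr (Filter.Eventually.of_forall fun φ => rfl)

/-- `φ ↦ D_{μ_0^φ}(g)` is `ν`-integrable. [folklore] -/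
private theorem integrable_dirichletForm_condLaw [IsFiniteMeasure (fieldLaw M h)] (g : (Fin n → ℤˣ) → ℝ) :
    Integrable (fun φ => dirichletForm (condLaw h φ) flipKernel g) (fieldLaw M h) := by
  have e : (fun φ => dirichletForm (condLaw h φ) flipKernel g)
      = fun φ => ∑ σ, condLaw h φ σ * ((1 / 2) * ∑ x, (g σ - g (flip x σ)) ^ 2) := by
    funext φ
    rw [dirichletForm_flipKernel, mul_sum]
    exact sum_congr rfl fun σ _ => by ring
  rw [e]
  exact integrable_fieldLaw_of_bounded (continuous_sum_condLaw_mul _) _ (abs_sum_condLaw_mul_le _)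

/-- `φ ↦ E_{μ_0^φ}[F]` is `ν`-integrable. [folklore] -/
private theorem integrable_condMean [IsFiniteMeasure (fieldLaw M h)] (F : (Fin n → ℤˣ) → ℝ) :
    Integrable (condMean h F) (fieldLaw M h) :=
  integrable_fieldLaw_of_bounded (continuous_sum_condLaw_mul _) _ (abs_sum_condLaw_mul_le _)

/-- **First term of (e:ent-decomp-Ising)**: `E_ν[Ent_{μ_0^φ}(F)] ≤ E_ν[D_{μ_0^φ}(√F)]` — the product
log-Sobolev inequality with `γ₀ = 2`, uniformly in `φ` ([BBD] (e:Ising-firstterm) with Prop. 15).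
[cite: BauerschmidtBodineauDagallier2023, §6.4.3 (e:Ising-firstterm)] -/
theorem integral_ent_condLaw_le [IsFiniteMeasure (fieldLaw M h)] {F : (Fin n → ℤˣ) → ℝ} (hF : ∀ σ, 0 ≤ F σ) :
    ∫ φ, ent (condLaw h φ) F ∂(fieldLaw M h)
      ≤ ∫ φ, dirichletForm (condLaw h φ) flipKernel (fun σ => Real.sqrt (F σ)) ∂(fieldLaw M h) :=
  integral_mono (integrable_ent_condLaw F) (integrable_dirichletForm_condLaw _) fun φ =>
    ent_tensorFun_le_dirichletForm_flipKernel (siteLaw (φ.ofLp + h)) (fun _ u => bw_pos _ u)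
      (fun _ => sum_bw _) hF

end FirstTerm

/-! ## §7 The second term: convexity of the renormalised potential and Exercise 5 -/

section Convexity

/-- `ℓ(u) = log(e^u + e^{−u})` (`= log 2cosh u`) and its derivative `th(u) = (e^u − e^{−u})/(e^u + e^{−u})`
satisfy the one-sided second-order bound `ℓ(b) ≤ ℓ(a) + th(a)(b − a) + (b − a)²/2` (`ℓ'' = 1 − th² ≤ 1`):
the single-site ingredient of "`V_0` is strictly convex … `Hess V_0 ≥ α − α²`" (in [BBD]'s variables).
[cite: BauerschmidtBodineauDagallier2023, §6.4.3 (e:lsiht-bis) (Exercise (ex_high_temperature_ising))] -/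
theorem log_exp_add_exp_neg_le (a b : ℝ) :
    Real.log (Real.exp b + Real.exp (-b))
      ≤ Real.log (Real.exp a + Real.exp (-a))
        + (Real.exp a - Real.exp (-a)) / (Real.exp a + Real.exp (-a)) * (b - a) + (b - a) ^ 2 / 2 := by
  set D : ℝ → ℝ := fun u => Real.exp u + Real.exp (-u) with hD
  set N : ℝ → ℝ := fun u => Real.exp u - Real.exp (-u) with hN
  have hD0 : ∀ u, 0 < D u := fun u => by simp only [hD]; positivity
  have hdD : ∀ u, HasDerivAt D (N u) u := fun u => by
    have h := (Real.hasDerivAt_exp u).add ((hasDerivAt_neg u).exp)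
    refine h.congr_deriv ?_; simp only [hN]; ring
  have hdN : ∀ u, HasDerivAt N (D u) u := fun u => by
    have h := (Real.hasDerivAt_exp u).sub ((hasDerivAt_neg u).exp)
    refine h.congr_deriv ?_; simp only [hD]; ring
  -- `ℓ' = N/D`, `(N/D)' = (D² − N²)/D² = 1 − (N/D)²`
  have hdl : ∀ u, HasDerivAt (fun u => Real.log (D u)) (N u / D u) u := fun u =>
    (hdD u).log (hD0 u).ne'
  have hdt : ∀ u, HasDerivAt (fun u => N u / D u) ((D u * D u - N u * N u) / D u ^ 2) u := fun u => by
    have h := (hdN u).div (hdD u) (hD0 u).ne'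
    refine h.congr_deriv ?_; ring
  -- `g(w) = N/D − w` is antitone
  have hdg : ∀ w, HasDerivAt (fun w => N w / D w - w) ((D w * D w - N w * N w) / D w ^ 2 - 1) w :=
    fun w => (hdt w).sub (hasDerivAt_id w)
  have hg : Antitone fun w => N w / D w - w := by
    refine antitone_of_deriv_nonpos (fun w => (hdg w).differentiableAt) fun w => ?_
    rw [(hdg w).deriv]
    have hDw : D w ≠ 0 := (hD0 w).ne'
    have h1 : (D w * D w - N w * N w) / D w ^ 2 - 1 = -(N w / D w) ^ 2 := by
      field_simp
      ring
    rw [h1]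
    exact neg_nonpos.2 (sq_nonneg _)
  -- `f(w) = ℓ(w) − th(a) w − (w − a)²/2` has `f' = g(w) − g(a)`
  set f : ℝ → ℝ := fun w => Real.log (D w) - N a / D a * w - (w - a) ^ 2 / 2 with hf
  have hdf : ∀ w, HasDerivAt f ((N w / D w - w) - (N a / D a - a)) w := fun w => by
    have h := ((hdl w).sub ((hasDerivAt_id w).const_mul (N a / D a))).sub
      (((hasDerivAt_id w).sub_const a).pow 2 |>.div_const 2)
    refine h.congr_deriv ?_
    simp only [id, Nat.cast_ofNat]
    ring
  have hfc : Continuous f := by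
    rw [hf]
    have hDc : Continuous D := by
      simp only [hD]; exact Real.continuous_exp.add (Real.continuous_exp.comp continuous_neg)
    exact ((hDc.log fun w => (hD0 w).ne').sub (continuous_const.mul continuous_id)).sub
      (((continuous_id.sub continuous_const).pow 2).div_const 2)
  have hfle : f b ≤ f a := by
    rcases le_total a b with hab | hab
    · -- `f` is non-increasing on `[a, ∞)`
      have hanti : AntitoneOn f (Set.Ici a) := by
        refine antitoneOn_of_deriv_nonpos (convex_Ici a) hfc.continuousOn
          (fun w _ => (hdf w).differentiableAt.differentiableWithinAt) ?_
        rw [interior_Ici]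
        intro w hw
        rw [(hdf w).deriv]
        have := hg (le_of_lt hw)
        linarith
      exact hanti (Set.mem_Ici.2 le_rfl) (Set.mem_Ici.2 hab) hab
    · -- `f` is non-decreasing on `(−∞, a]`
      have hmono : MonotoneOn f (Set.Iic a) := by
        refine monotoneOn_of_deriv_nonneg (convex_Iic a) hfc.continuousOn
          (fun w _ => (hdf w).differentiableAt.differentiableWithinAt) ?_
        rw [interior_Iic]
        intro w hw
        rw [(hdf w).deriv]
        have := hg (le_of_lt hw)
        linarith
      exact hmono (Set.mem_Iic.2 hab) (Set.mem_Iic.2 le_rfl) hab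
  simp only [hf, hD, hN] at hfle
  have e : (a - a) ^ 2 / 2 = 0 := by ring
  rw [e] at hfle
  linarith

variable {M : Matrix (Fin n) (Fin n) ℝ} {h : Fin n → ℝ} {c : ℝ}

/-- `th(u) = (e^u − e^{−u})/(e^u + e^{−u})`, the mean spin in the field `u`. [folklore] -/
private def th (u : ℝ) : ℝ := (Real.exp u - Real.exp (-u)) / (Real.exp u + Real.exp (-u))

/-- The gradient field of `U`: `∇U(φ) = Mφ − (th(φ_x + h_x))_x`.
[cite: BauerschmidtBodineauDagallier2023, §6.4.3 (Exercise (ex_high_temperature_ising))] -/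
def gradPot (M : Matrix (Fin n) (Fin n) ℝ) (h : Fin n → ℝ) (φ : EuclideanSpace ℝ (Fin n)) :
    EuclideanSpace ℝ (Fin n) :=
  WithLp.toLp 2 (M *ᵥ φ.ofLp - fun j => th (φ.ofLp j + h j))

/-- `⟪toLp w, z⟫ = Σ_j w_j z_j`. [folklore] -/
private theorem inner_toLp (w : Fin n → ℝ) (z : EuclideanSpace ℝ (Fin n)) :
    ⟪(WithLp.toLp 2 w : EuclideanSpace ℝ (Fin n)), z⟫ = ∑ j, w j * z.ofLp j := by
  rw [PiLp.inner_apply]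
  exact sum_congr rfl fun j _ => by simp [mul_comm]

/-- Exact second-order expansion of the quadratic part for symmetric `M`:
`½(y,My) = ½(x,Mx) + (Mx, y − x) + ½(y − x, M(y − x))`. [folklore] -/
private theorem qf_expand (hMt : Mᵀ = M) (x y : EuclideanSpace ℝ (Fin n)) :
    (1 / 2) * qf M y = (1 / 2) * qf M x + (M *ᵥ x.ofLp) ⬝ᵥ (y - x).ofLp + (1 / 2) * qf M (y - x) := by
  unfold qf
  rw [WithLp.ofLp_sub]
  set a := x.ofLp
  set b := y.ofLp
  have hs : ∀ u w : Fin n → ℝ, u ⬝ᵥ (M *ᵥ w) = (M *ᵥ u) ⬝ᵥ w := fun u w => by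
    rw [dotProduct_mulVec, ← mulVec_transpose, hMt]
  have e : b = a + (b - a) := by abel
  conv_lhs => rw [e]
  rw [mulVec_add, add_dotProduct, dotProduct_add, dotProduct_add, hs (b - a) a, dotProduct_comm (M *ᵥ (b - a)) a,
    hs a (b - a)]
  ring

/-- **Uniform convexity of the renormalised potential** (Bakry–Émery hypothesis in first-order form):
if `M` is symmetric with `M ≥ 1/c`, then for all `x, y ∈ ℝ^Λ`,
`U(x) + ⟨∇U(x), y − x⟩ + ((1/c − 1)/2)‖y − x‖² ≤ U(y)` — [BBD]: "if `β < α < 1` then `V_0` is strictly convex so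
that the standard Bakry–Émery criterion is applicable … `γ_{0,β} ≥ α − α²`" (our `φ = αφ_{BBD}`, `c = α`).
[cite: BauerschmidtBodineauDagallier2023, §6.4.3 (e:lsiht-bis)] -/
theorem fieldPot_uniformlyConvex (hMt : Mᵀ = M)
    (hM : ∀ v : Fin n → ℝ, v ⬝ᵥ v / c ≤ v ⬝ᵥ (M *ᵥ v)) (x y : EuclideanSpace ℝ (Fin n)) :
    fieldPot M h x + ⟪gradPot M h x, y - x⟫ + (1 / c - 1) / 2 * ‖y - x‖ ^ 2 ≤ fieldPot M h y := by
  unfold fieldPot gradPot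
  rw [inner_toLp, qf_expand hMt x y]
  -- the single-site terms
  have hsite : ∀ j, Real.log (Real.exp ((y.ofLp + h) j) + Real.exp (-((y.ofLp + h) j)))
      ≤ Real.log (Real.exp ((x.ofLp + h) j) + Real.exp (-((x.ofLp + h) j)))
        + th (x.ofLp j + h j) * ((y - x).ofLp j) + ((y - x).ofLp j) ^ 2 / 2 := by
    intro j
    have hl := log_exp_add_exp_neg_le ((x.ofLp + h) j) ((y.ofLp + h) j)
    have e1 : (y.ofLp + h) j - (x.ofLp + h) j = (y - x).ofLp j := by
      rw [WithLp.ofLp_sub]; simp only [Pi.add_apply, Pi.sub_apply]; ring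
    rw [e1] at hl
    exact hl
  have hsum := sum_le_sum fun j (_ : j ∈ univ) => hsite j
  rw [sum_add_distrib, sum_add_distrib] at hsum
  -- `‖y − x‖² = Σ_j (y − x)_j²` and the quadratic lower bound
  have hn : ‖y - x‖ ^ 2 = ∑ j, ((y - x).ofLp j) ^ 2 := EuclideanSpace.real_norm_sq_eq _
  have hq : ‖y - x‖ ^ 2 / c ≤ qf M (y - x) := by
    rw [norm_sq_eq_dot]; exact hM _
  have hlin : ∑ j, (M *ᵥ x.ofLp - fun j => th (x.ofLp j + h j)) j * (y - x).ofLp j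
      = (M *ᵥ x.ofLp) ⬝ᵥ (y - x).ofLp - ∑ j, th (x.ofLp j + h j) * (y - x).ofLp j := by
    rw [dotProduct, ← sum_sub_distrib]
    exact sum_congr rfl fun j _ => by simp only [Pi.sub_apply]; ring
  rw [hlin]
  have hsq : ∑ j, ((y - x).ofLp j) ^ 2 / 2 = ‖y - x‖ ^ 2 / 2 := by rw [hn, sum_div]
  rw [hsq] at hsum
  have hc' : (1 / c - 1) / 2 * ‖y - x‖ ^ 2 = (‖y - x‖ ^ 2 / c) / 2 - ‖y - x‖ ^ 2 / 2 := by ring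
  rw [hc']
  linarith

end Convexity

/-! ### Exercise 5: the covariance of `F` with one spin under a product measure, against one-flip moves -/

section ExerciseFive

variable {pw : Fin n → ℤˣ → ℝ}

/-- `(σ^x)^x = σ`. [folklore] -/
private theorem flip_flip (x : Fin n) (σ : Fin n → ℤˣ) : flip x (flip x σ) = σ := by
  unfold flip
  rw [Function.update_idem, Function.update_self, neg_neg, Function.update_eq_self]

/-- Reindexing a sum over configurations by the involution `σ ↦ σ^x`. [folklore] -/
private theorem sum_comp_flip (x : Fin n) (g : (Fin n → ℤˣ) → ℝ) : ∑ σ, g (flip x σ) = ∑ σ, g σ :=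
  Fintype.sum_bijective (flip x) (Function.Involutive.bijective (flip_flip x)) _ _ fun _ => rfl

/-- Marginals of a product measure: `Σ_σ (⊗pw)(σ) f(σ_x) = Σ_u pw_x(u) f(u)` (the other factors sum to `1`).
[folklore] -/
private theorem sum_tensorFun_mul_apply (hpw1 : ∀ i, ∑ u, pw i u = 1) (x : Fin n) (f : ℤˣ → ℝ) :
    ∑ σ : Fin n → ℤˣ, tensorFun pw σ * f (σ x) = ∑ u, pw x u * f u := by
  set pw' : Fin n → ℤˣ → ℝ := Function.update pw x (fun u => pw x u * f u) with hpw'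
  have e : ∀ σ : Fin n → ℤˣ, tensorFun pw σ * f (σ x) = tensorFun pw' σ := by
    intro σ
    rw [tensorFun_eq_mul_prod pw σ x, tensorFun_eq_mul_prod pw' σ x]
    have h1 : pw' x (σ x) = pw x (σ x) * f (σ x) := by rw [hpw', Function.update_self]
    have h2 : ∏ i ∈ univ \ {x}, pw' i (σ i) = ∏ i ∈ univ \ {x}, pw i (σ i) :=
      prod_congr rfl fun i hi => by
        have hix : i ≠ x := by simpa using hi
        rw [hpw', Function.update_of_ne hix]
    rw [h1, h2]; ring
  simp_rw [e]
  rw [sum_tensorFun, ← Finset.mul_prod_erase _ _ (mem_univ x)]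
  have h3 : ∏ i ∈ univ.erase x, ∑ u, pw' i u = 1 := prod_eq_one fun i hi => by
    have hix : i ≠ x := ne_of_mem_erase hi
    rw [hpw', Function.update_of_ne hix, hpw1 i]
  rw [h3, mul_one, hpw', Function.update_self]

/-- Product structure along one flip: `(⊗pw)(σ^x) pw_x(σ_x) = (⊗pw)(σ) pw_x(−σ_x)` (detailed balance of the flip
against the product measure). [folklore] -/
private theorem tensorFun_flip_mul (x : Fin n) (σ : Fin n → ℤˣ) :
    tensorFun pw (flip x σ) * pw x (σ x) = tensorFun pw σ * pw x (-σ x) := by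
  unfold flip
  rw [tensorFun_update, tensorFun_eq_mul_prod pw σ x]
  ring

/-- **Exercise 5** ([BBD] (eq: borne cov 1ere inegalite)–(eq: borne cov 2nd inegalite), assembled): for a
product measure `m = ⊗_x pw_x` of positive probability vectors on `{±1}^Λ`, `F ≥ 0` and a site `x`,
`Cov_m(F, σ_x)² ≤ 4 E_m[F] · ½ E_m[(√F(σ) − √F(σ^x))²]`, where
`Cov_m(F,σ_x) = E_m[Fσ_x] − E_m[F](pw_x(+1) − pw_x(−1))`.  Printed road: `Cov = E[Cov_x]`, `Cov_x² ≤ 8 E_x[F]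
Var_x(√F)`, `Var_x ≤ ½D_x` on two points, Cauchy–Schwarz; here run as ONE Cauchy–Schwarz on the identity
`Cov_m(F,σ_x) = Σ_σ m(σ) pw_x(−σ_x) σ_x (F(σ) − F(σ^x))`.
[cite: BauerschmidtBodineauDagallier2023, §6.4.3 Exercise 5] -/
theorem cov_spin_sq_le (hpw : ∀ i u, 0 < pw i u) (hpw1 : ∀ i, ∑ u, pw i u = 1) {F : (Fin n → ℤˣ) → ℝ}
    (hF : ∀ σ, 0 ≤ F σ) (x : Fin n) :
    (∑ σ, tensorFun pw σ * F σ * sv σ x - (∑ σ, tensorFun pw σ * F σ) * (pw x 1 - pw x (-1))) ^ 2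
      ≤ 4 * (∑ σ, tensorFun pw σ * F σ)
          * ((1 / 2) * ∑ σ, tensorFun pw σ * (Real.sqrt (F σ) - Real.sqrt (F (flip x σ))) ^ 2) := by
  set m : (Fin n → ℤˣ) → ℝ := tensorFun pw with hm
  have hm0 : ∀ σ, 0 < m σ := fun σ => tensorFun_pos hpw σ
  set p : (Fin n → ℤˣ) → ℝ := fun σ => pw x (-σ x) with hp
  have hp0 : ∀ σ, 0 ≤ p σ := fun σ => (hpw x _).le
  have hsum1 : pw x 1 + pw x (-1) = 1 := by
    have h := hpw1 x
    have huniv : (univ : Finset ℤˣ) = {1, -1} := by decide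
    rwa [huniv, Finset.sum_pair (by decide)] at h
  have hp1 : ∀ σ, p σ ≤ 1 := fun σ => by
    rcases Int.units_eq_one_or (σ x) with h1 | h1 <;> simp only [hp, h1, neg_neg]
    · linarith [hpw x 1]
    · linarith [hpw x (-1)]
  -- Step A/B: `Cov = Σ m (s − t) F` and `s − t = 2 p s`
  have hst : ∀ σ, sv σ x - (pw x 1 - pw x (-1)) = 2 * p σ * sv σ x := fun σ => by
    unfold sv spin
    rcases Int.units_eq_one_or (σ x) with h1 | h1 <;> simp only [hp, h1, neg_neg] <;> push_cast <;> linarith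
  have hA : ∑ σ, m σ * F σ * sv σ x - (∑ σ, m σ * F σ) * (pw x 1 - pw x (-1))
      = 2 * ∑ σ, m σ * p σ * sv σ x * F σ := by
    rw [sum_mul, ← sum_sub_distrib, mul_sum]
    refine sum_congr rfl fun σ _ => ?_
    have := hst σ
    calc m σ * F σ * sv σ x - m σ * F σ * (pw x 1 - pw x (-1))
        = m σ * F σ * (sv σ x - (pw x 1 - pw x (-1))) := by ring
      _ = 2 * (m σ * p σ * sv σ x * F σ) := by rw [this]; ring
  -- Step C: `T = Σ m p s (F − F^x) = 2 Σ m p s F`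
  have hflipx : ∀ σ : Fin n → ℤˣ, (flip x σ) x = -σ x := fun σ => by unfold flip; rw [Function.update_self]
  have hC : ∑ σ, m σ * p σ * sv σ x * (F σ - F (flip x σ)) = 2 * ∑ σ, m σ * p σ * sv σ x * F σ := by
    have hre : ∑ σ, m σ * p σ * sv σ x * F (flip x σ) = -∑ σ, m σ * p σ * sv σ x * F σ := by
      rw [← sum_comp_flip x (fun σ => m σ * p σ * sv σ x * F σ), ← sum_neg_distrib]
      refine sum_congr rfl fun σ _ => ?_
      have h1 : p (flip x σ) = pw x (σ x) := by simp only [hp, hflipx, neg_neg]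
      have h2 : sv (flip x σ) x = -sv σ x := by rw [sv_flip, if_pos rfl]
      have h3 : m (flip x σ) * pw x (σ x) = m σ * p σ := tensorFun_flip_mul x σ
      rw [h1, h2, show -(m (flip x σ) * pw x (σ x) * -sv σ x * F (flip x σ))
          = (m (flip x σ) * pw x (σ x)) * sv σ x * F (flip x σ) by ring, h3]
    simp_rw [mul_sub]
    rw [sum_sub_distrib, hre]
    ring
  -- Step D: Cauchy–Schwarz with `F − F^x = (√F − √F^x)(√F + √F^x)`
  have hCS : (∑ σ, m σ * p σ * sv σ x * (F σ - F (flip x σ))) ^ 2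
      ≤ (∑ σ, m σ * (Real.sqrt (F σ) - Real.sqrt (F (flip x σ))) ^ 2)
        * ∑ σ, m σ * (p σ * sv σ x * (Real.sqrt (F σ) + Real.sqrt (F (flip x σ)))) ^ 2 := by
    have h := sum_mul_sq_le_sq_mul_sq univ
      (fun σ => Real.sqrt (m σ) * (Real.sqrt (F σ) - Real.sqrt (F (flip x σ))))
      (fun σ => Real.sqrt (m σ) * (p σ * sv σ x * (Real.sqrt (F σ) + Real.sqrt (F (flip x σ)))))
    have e1 : ∀ σ, Real.sqrt (m σ) * (Real.sqrt (F σ) - Real.sqrt (F (flip x σ)))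
        * (Real.sqrt (m σ) * (p σ * sv σ x * (Real.sqrt (F σ) + Real.sqrt (F (flip x σ)))))
        = m σ * p σ * sv σ x * (F σ - F (flip x σ)) := by
      intro σ
      have hmm : Real.sqrt (m σ) * Real.sqrt (m σ) = m σ := Real.mul_self_sqrt (hm0 σ).le
      have hFF : (Real.sqrt (F σ) - Real.sqrt (F (flip x σ))) * (Real.sqrt (F σ) + Real.sqrt (F (flip x σ)))
          = F σ - F (flip x σ) := by
        nlinarith [Real.mul_self_sqrt (hF σ), Real.mul_self_sqrt (hF (flip x σ))]
      calc _ = (Real.sqrt (m σ) * Real.sqrt (m σ)) * (p σ * sv σ x)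
            * ((Real.sqrt (F σ) - Real.sqrt (F (flip x σ))) * (Real.sqrt (F σ) + Real.sqrt (F (flip x σ)))) := by
              ring
        _ = _ := by rw [hmm, hFF]; ring
    have e2 : ∀ σ, (Real.sqrt (m σ) * (Real.sqrt (F σ) - Real.sqrt (F (flip x σ)))) ^ 2
        = m σ * (Real.sqrt (F σ) - Real.sqrt (F (flip x σ))) ^ 2 := by
      intro σ; rw [mul_pow, Real.sq_sqrt (hm0 σ).le]
    have e3 : ∀ σ, (Real.sqrt (m σ) * (p σ * sv σ x * (Real.sqrt (F σ) + Real.sqrt (F (flip x σ))))) ^ 2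
        = m σ * (p σ * sv σ x * (Real.sqrt (F σ) + Real.sqrt (F (flip x σ)))) ^ 2 := by
      intro σ; rw [mul_pow, Real.sq_sqrt (hm0 σ).le]
    simp_rw [e1, e2, e3] at h
    exact h
  -- Step E: the second factor is at most `2 E_m[F]`
  have hE : ∑ σ, m σ * (p σ * sv σ x * (Real.sqrt (F σ) + Real.sqrt (F (flip x σ)))) ^ 2
      ≤ 2 * ∑ σ, m σ * F σ := by
    have hs2 : ∀ σ, sv σ x ^ 2 = 1 := fun σ => by rw [sq, sv_mul_self]
    have step1 : ∀ σ, m σ * (p σ * sv σ x * (Real.sqrt (F σ) + Real.sqrt (F (flip x σ)))) ^ 2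
        ≤ 2 * (m σ * p σ ^ 2 * F σ) + 2 * (m σ * p σ ^ 2 * F (flip x σ)) := by
      intro σ
      rw [mul_pow, mul_pow, hs2, mul_one]
      have hsq : (Real.sqrt (F σ) + Real.sqrt (F (flip x σ))) ^ 2 ≤ 2 * (F σ + F (flip x σ)) := by
        nlinarith [Real.sq_sqrt (hF σ), Real.sq_sqrt (hF (flip x σ)),
          sq_nonneg (Real.sqrt (F σ) - Real.sqrt (F (flip x σ)))]
      have hmp : 0 ≤ m σ * p σ ^ 2 := mul_nonneg (hm0 σ).le (sq_nonneg _)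
      nlinarith
    refine (sum_le_sum fun σ _ => step1 σ).trans ?_
    rw [sum_add_distrib, ← mul_sum, ← mul_sum]
    -- reindex the second sum by the flip
    have hre : ∑ σ, m σ * p σ ^ 2 * F (flip x σ) = ∑ σ, m σ * p σ * pw x (σ x) * F σ := by
      rw [← sum_comp_flip x (fun σ => m σ * p σ * pw x (σ x) * F σ)]
      refine sum_congr rfl fun σ _ => ?_
      have h1 : p (flip x σ) = pw x (σ x) := by simp only [hp, hflipx, neg_neg]
      have h3 : m (flip x σ) * pw x (σ x) = m σ * p σ := tensorFun_flip_mul x σ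
      rw [h1, hflipx, show m (flip x σ) * pw x (σ x) * pw x (-σ x) * F (flip x σ)
          = (m (flip x σ) * pw x (σ x)) * pw x (-σ x) * F (flip x σ) by ring, h3]
      simp only [hp]
      ring
    rw [hre, ← mul_add, ← sum_add_distrib]
    refine mul_le_mul_of_nonneg_left (sum_le_sum fun σ _ => ?_) (by norm_num)
    have hpp : p σ + pw x (σ x) = 1 := by
      rcases Int.units_eq_one_or (σ x) with h1 | h1 <;> simp only [hp, h1, neg_neg] <;> linarith
    calc m σ * p σ ^ 2 * F σ + m σ * p σ * pw x (σ x) * F σ = m σ * F σ * p σ * (p σ + pw x (σ x)) := by ring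
      _ = m σ * F σ * p σ := by rw [hpp, mul_one]
      _ ≤ m σ * F σ * 1 := mul_le_mul_of_nonneg_left (hp1 σ) (mul_nonneg (hm0 σ).le (hF σ))
      _ = m σ * F σ := mul_one _
  -- assemble
  have hG0 : 0 ≤ ∑ σ, m σ * F σ := sum_nonneg fun σ _ => mul_nonneg (hm0 σ).le (hF σ)
  have hD0 : 0 ≤ ∑ σ, m σ * (Real.sqrt (F σ) - Real.sqrt (F (flip x σ))) ^ 2 :=
    sum_nonneg fun σ _ => mul_nonneg (hm0 σ).le (sq_nonneg _)
  rw [hA, ← hC]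
  calc (∑ σ, m σ * p σ * sv σ x * (F σ - F (flip x σ))) ^ 2
      ≤ (∑ σ, m σ * (Real.sqrt (F σ) - Real.sqrt (F (flip x σ))) ^ 2)
        * ∑ σ, m σ * (p σ * sv σ x * (Real.sqrt (F σ) + Real.sqrt (F (flip x σ)))) ^ 2 := hCS
    _ ≤ (∑ σ, m σ * (Real.sqrt (F σ) - Real.sqrt (F (flip x σ))) ^ 2) * (2 * ∑ σ, m σ * F σ) :=
        mul_le_mul_of_nonneg_left hE hD0
    _ = 4 * (∑ σ, m σ * F σ) * ((1 / 2) * ∑ σ, m σ * (Real.sqrt (F σ) - Real.sqrt (F (flip x σ))) ^ 2) := by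
        ring

/-- Summing Exercise 5 over the sites: `Σ_x Cov_m(F,σ_x)²/(4E_m[F]) ≤ D_m(√F)` for the standard single-flip
Dirichlet form — the inequality `|∇_φ (E_{μ_0^φ}[F])^{1/2}|² ≤ (stuff) D_{μ_0^φ}(√F)` of (e:Ising-secondterm)
with the constants of the present normalisation. [cite: BauerschmidtBodineauDagallier2023, §6.4.3
(e:Ising-secondterm), Exercise 5] -/
theorem sum_cov_spin_sq_div_le (hpw : ∀ i u, 0 < pw i u) (hpw1 : ∀ i, ∑ u, pw i u = 1)
    {F : (Fin n → ℤˣ) → ℝ} (hF : ∀ σ, 0 ≤ F σ) (hG : 0 < ∑ σ, tensorFun pw σ * F σ) :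
    (∑ x, (∑ σ, tensorFun pw σ * F σ * sv σ x - (∑ σ, tensorFun pw σ * F σ) * (pw x 1 - pw x (-1))) ^ 2)
        / (4 * ∑ σ, tensorFun pw σ * F σ)
      ≤ dirichletForm (tensorFun pw) flipKernel (fun σ => Real.sqrt (F σ)) := by
  have h4G : 0 < 4 * ∑ σ, tensorFun pw σ * F σ := by linarith
  rw [dirichletForm_flipKernel, div_le_iff₀ h4G]
  have e : (1 / 2 : ℝ) * ∑ σ, tensorFun pw σ * ∑ x, (Real.sqrt (F σ) - Real.sqrt (F (flip x σ))) ^ 2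
      = ∑ x, (1 / 2) * ∑ σ, tensorFun pw σ * (Real.sqrt (F σ) - Real.sqrt (F (flip x σ))) ^ 2 := by
    have : ∑ σ, tensorFun pw σ * ∑ x, (Real.sqrt (F σ) - Real.sqrt (F (flip x σ))) ^ 2
        = ∑ x, ∑ σ, tensorFun pw σ * (Real.sqrt (F σ) - Real.sqrt (F (flip x σ))) ^ 2 := by
      simp_rw [mul_sum]
      exact sum_comm
    rw [this, mul_sum]
  rw [e, sum_mul]
  refine sum_le_sum fun x _ => ?_
  have h := cov_spin_sq_le hpw hpw1 hF x
  linarith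

end ExerciseFive

/-! ### The gradient of `(E_{μ_0^φ}[F])^{1/2}` ([BBD] Exercise 5, first display) -/

section Gradient

variable {h : Fin n → ℝ}

/-- `e_σ(φ) = e^{Σ_x (φ_x + h_x)σ_x}`, the unnormalised weight of `σ` under `μ_0^φ`. [folklore] -/
def expW (h : Fin n → ℝ) (σ : Fin n → ℤˣ) (φ : EuclideanSpace ℝ (Fin n)) : ℝ :=
  Real.exp (∑ j, (φ.ofLp j + h j) * sv σ j)

/-- The linear form `v ↦ (v, σ) = Σ_x σ_x v_x` on `ℝ^Λ`. [folklore] -/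
def linL (σ : Fin n → ℤˣ) : EuclideanSpace ℝ (Fin n) →L[ℝ] ℝ :=
  ∑ j, sv σ j • PiLp.proj 2 (fun _ : Fin n => ℝ) j

/-- `(v, σ) = Σ_x σ_x v_x`. [folklore] -/
private theorem linL_apply (σ : Fin n → ℤˣ) (v : EuclideanSpace ℝ (Fin n)) : linL σ v = ∑ j, sv σ j * v.ofLp j := by
  unfold linL
  rw [_root_.sum_apply]
  exact sum_congr rfl fun j _ => by rw [_root_.smul_apply, PiLp.proj_apply, smul_eq_mul]

/-- `e_σ > 0`. [folklore] -/
private theorem expW_pos (σ : Fin n → ℤˣ) (φ : EuclideanSpace ℝ (Fin n)) : 0 < expW h σ φ := Real.exp_pos _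

/-- `De_σ(φ) = e_σ(φ) (·, σ)`. [folklore] -/
private theorem hasFDerivAt_expW (σ : Fin n → ℤˣ) (φ : EuclideanSpace ℝ (Fin n)) :
    HasFDerivAt (expW h σ) (expW h σ φ • linL σ) φ := by
  have ha : HasFDerivAt (fun φ : EuclideanSpace ℝ (Fin n) => ∑ j, (φ.ofLp j + h j) * sv σ j) (linL σ) φ := by
    unfold linL
    exact HasFDerivAt.fun_sum fun j _ =>
      ((PiLp.hasFDerivAt_apply 2 φ j).add_const (h j)).mul_const (sv σ j)
  exact ha.exp

/-- `e_σ` is smooth. [folklore] -/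
private theorem contDiff_expW (σ : Fin n → ℤˣ) : ContDiff ℝ 1 (expW h σ) := by
  unfold expW
  refine Real.contDiff_exp.comp (ContDiff.sum fun j _ => ?_)
  exact (((PiLp.proj (𝕜 := ℝ) 2 (fun _ : Fin n => ℝ) j).contDiff).add contDiff_const).mul contDiff_const

/-- `μ_0^φ(σ) = e_σ(φ) / Σ_τ e_τ(φ)`. [cite: BauerschmidtBodineauDagallier2023, §6.4.1 (e:muphi)] -/
theorem condLaw_eq_expW_div (φ : EuclideanSpace ℝ (Fin n)) (σ : Fin n → ℤˣ) :
    condLaw h φ σ = expW h σ φ / ∑ τ, expW h τ φ := by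
  rw [condLaw_eq, ← sum_exp_dot_sv]
  rfl

/-- `E_{μ_0^φ}[F] = (Σ_σ F(σ)e_σ(φ)) / Σ_τ e_τ(φ)`. [folklore] -/
private theorem condMean_eq_div (F : (Fin n → ℤˣ) → ℝ) (φ : EuclideanSpace ℝ (Fin n)) :
    condMean h F φ = (∑ σ, F σ * expW h σ φ) / ∑ τ, expW h τ φ := by
  unfold condMean
  simp_rw [condLaw_eq_expW_div]
  rw [sum_div]
  exact sum_congr rfl fun σ _ => by ring

/-- `Σ_τ e_τ(φ) > 0`. [folklore] -/
private theorem sum_expW_pos (φ : EuclideanSpace ℝ (Fin n)) : 0 < ∑ τ, expW h τ φ :=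
  sum_pos (fun τ _ => expW_pos τ φ) ⟨fun _ => 1, mem_univ _⟩

/-- `(E_{μ_0^φ}[F])^{1/2}` is `C¹` in `φ` when `E_{μ_0^φ}[F]` never vanishes. [folklore] -/
private theorem contDiff_sqrt_condMean (F : (Fin n → ℤˣ) → ℝ) (hG : ∀ φ, condMean h F φ ≠ 0) :
    ContDiff ℝ 1 (fun φ => Real.sqrt (condMean h F φ)) := by
  have hN : ContDiff ℝ 1 (fun φ => ∑ σ, F σ * expW h σ φ) :=
    ContDiff.sum fun σ _ => contDiff_const.mul (contDiff_expW σ)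
  have hD : ContDiff ℝ 1 (fun φ => ∑ τ, expW h τ φ) := ContDiff.sum fun τ _ => contDiff_expW τ
  have hG' : ContDiff ℝ 1 (condMean h F) := by
    have e : condMean h F = fun φ => (∑ σ, F σ * expW h σ φ) / ∑ τ, expW h τ φ :=
      funext (condMean_eq_div F)
    rw [e]
    exact hN.div hD fun φ => (sum_expW_pos φ).ne'
  exact hG'.sqrt hG

/-- The mean spin: `E_{μ_0^φ}[σ_x] = π_x(+1) − π_x(−1)`. [folklore] -/
private theorem sum_condLaw_mul_sv (φ : EuclideanSpace ℝ (Fin n)) (x : Fin n) :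
    ∑ σ, condLaw h φ σ * sv σ x = siteLaw (φ.ofLp + h) x 1 - siteLaw (φ.ofLp + h) x (-1) := by
  unfold condLaw sv spin
  rw [sum_tensorFun_mul_apply (pw := siteLaw (φ.ofLp + h)) (fun _ => sum_bw _) x (fun u : ℤˣ => ((u : ℤ) : ℝ))]
  have huniv : (univ : Finset ℤˣ) = {1, -1} := by decide
  rw [huniv, Finset.sum_pair (by decide)]
  push_cast
  ring

/-- Discrete Cauchy–Schwarz in the form `|Σ_j b_j v_j| ≤ (Σ_j b_j²)^{1/2} ‖v‖` on `ℝ^Λ`. [folklore] -/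
private theorem abs_sum_mul_le (b : Fin n → ℝ) (v : EuclideanSpace ℝ (Fin n)) :
    |∑ j, b j * v.ofLp j| ≤ Real.sqrt (∑ j, b j ^ 2) * ‖v‖ := by
  have h := sum_mul_sq_le_sq_mul_sq univ b (fun j => v.ofLp j)
  have hn : ∑ j, v.ofLp j ^ 2 = ‖v‖ ^ 2 := (EuclideanSpace.real_norm_sq_eq v).symm
  rw [hn] at h
  rw [← Real.sqrt_sq (norm_nonneg v), ← Real.sqrt_mul (sum_nonneg fun j _ => sq_nonneg _),
    ← Real.sqrt_sq_eq_abs]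
  exact Real.sqrt_le_sqrt h

/-- `Cov_{μ_0^φ}(F, σ_x) = E_{μ_0^φ}[Fσ_x] − E_{μ_0^φ}[F] E_{μ_0^φ}[σ_x]`.
[cite: BauerschmidtBodineauDagallier2023, §6.4.3 Exercise 5] -/
def cov (h : Fin n → ℝ) (F : (Fin n → ℤˣ) → ℝ) (φ : EuclideanSpace ℝ (Fin n)) (x : Fin n) : ℝ :=
  ∑ σ, condLaw h φ σ * F σ * sv σ x - condMean h F φ * ∑ σ, condLaw h φ σ * sv σ x

/-- The differential of `φ ↦ E_{μ_0^φ}[F]`: `v ↦ Σ_x Cov_{μ_0^φ}(F,σ_x) v_x` (Exercise 5, first display: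
`∇_{φ_x} E_{μ_0^φ}[F] = Cov_{μ_0^φ}(F,σ_x)`, with `α = 1` in our variables).
[cite: BauerschmidtBodineauDagallier2023, §6.4.3 Exercise 5] -/
def covCLM (h : Fin n → ℝ) (F : (Fin n → ℤˣ) → ℝ) (φ : EuclideanSpace ℝ (Fin n)) :
    EuclideanSpace ℝ (Fin n) →L[ℝ] ℝ :=
  ∑ x, cov h F φ x • PiLp.proj 2 (fun _ : Fin n => ℝ) x

/-- `covCLM v = Σ_x Cov(F,σ_x) v_x`. [folklore] -/
private theorem covCLM_apply (F : (Fin n → ℤˣ) → ℝ) (φ v : EuclideanSpace ℝ (Fin n)) :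
    covCLM h F φ v = ∑ x, cov h F φ x * v.ofLp x := by
  unfold covCLM
  rw [_root_.sum_apply]
  exact sum_congr rfl fun j _ => by rw [_root_.smul_apply, PiLp.proj_apply, smul_eq_mul]

/-- **`D(E_{μ_0^φ}[F]) = Σ_x Cov_{μ_0^φ}(F,σ_x) dφ_x`** (quotient rule on `(Σ_σ F e_σ)/(Σ_τ e_τ)`).
[cite: BauerschmidtBodineauDagallier2023, §6.4.3 Exercise 5 (first display)] -/
theorem hasFDerivAt_condMean (F : (Fin n → ℤˣ) → ℝ) (φ : EuclideanSpace ℝ (Fin n)) :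
    HasFDerivAt (condMean h F) (covCLM h F φ) φ := by
  have hD0 : ∀ ψ : EuclideanSpace ℝ (Fin n), (∑ τ, expW h τ ψ) ≠ 0 := fun ψ => (sum_expW_pos ψ).ne'
  have hN : HasFDerivAt (fun ψ : EuclideanSpace ℝ (Fin n) => ∑ σ, F σ * expW h σ ψ)
      (∑ σ, F σ • (expW h σ φ • linL σ)) φ :=
    HasFDerivAt.fun_sum fun σ _ => (hasFDerivAt_expW σ φ).const_mul (F σ)
  have hD : HasFDerivAt (fun ψ : EuclideanSpace ℝ (Fin n) => ∑ τ, expW h τ ψ)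
      (∑ σ, expW h σ φ • linL σ) φ :=
    HasFDerivAt.fun_sum fun σ _ => hasFDerivAt_expW σ φ
  have hDinv : HasFDerivAt (fun ψ : EuclideanSpace ℝ (Fin n) => (∑ τ, expW h τ ψ)⁻¹)
      ((-((∑ τ, expW h τ φ) ^ 2)⁻¹) • ∑ σ, expW h σ φ • linL σ) φ :=
    (hasDerivAt_inv (hD0 φ)).comp_hasFDerivAt φ hD
  have hG := hN.mul hDinv
  have e : condMean h F = fun ψ => (∑ σ, F σ * expW h σ ψ) * (∑ τ, expW h τ ψ)⁻¹ :=
    funext fun ψ => by rw [condMean_eq_div, div_eq_mul_inv]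
  rw [e]
  refine hG.congr_fderiv (ContinuousLinearMap.ext fun v => ?_)
  -- evaluate both sides at `v`
  set Dφ : ℝ := ∑ τ, expW h τ φ with hDφ
  set Nφ : ℝ := ∑ σ, F σ * expW h σ φ with hNφ
  have eN' : (∑ σ, F σ • (expW h σ φ • linL σ)) v = ∑ σ, F σ * (expW h σ φ * linL σ v) := by
    rw [_root_.sum_apply]
    exact sum_congr rfl fun σ _ => by rw [_root_.smul_apply, _root_.smul_apply, smul_eq_mul, smul_eq_mul]
  have eD' : (∑ σ, expW h σ φ • linL σ) v = ∑ σ, expW h σ φ * linL σ v := by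
    rw [_root_.sum_apply]
    exact sum_congr rfl fun σ _ => by rw [_root_.smul_apply, smul_eq_mul]
  rw [_root_.add_apply, _root_.smul_apply, _root_.smul_apply, _root_.smul_apply, eN', eD', smul_eq_mul,
    smul_eq_mul, smul_eq_mul, covCLM_apply]
  -- the covariance side
  have hm : ∀ σ, condLaw h φ σ = expW h σ φ / Dφ := fun σ => condLaw_eq_expW_div φ σ
  have hGm : condMean h F φ = Nφ / Dφ := condMean_eq_div F φ
  have e1 : ∑ x, (∑ σ, condLaw h φ σ * F σ * sv σ x) * v.ofLp x
      = Dφ⁻¹ * ∑ σ, F σ * (expW h σ φ * linL σ v) := by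
    simp_rw [sum_mul, mul_sum]
    rw [sum_comm]
    refine sum_congr rfl fun σ _ => ?_
    rw [linL_apply, mul_sum, mul_sum, mul_sum]
    exact sum_congr rfl fun x _ => by rw [hm, div_eq_mul_inv]; ring
  have e2 : ∑ x, (∑ σ, condLaw h φ σ * sv σ x) * v.ofLp x = Dφ⁻¹ * ∑ σ, expW h σ φ * linL σ v := by
    simp_rw [sum_mul, mul_sum]
    rw [sum_comm]
    refine sum_congr rfl fun σ _ => ?_
    rw [linL_apply, mul_sum, mul_sum]
    exact sum_congr rfl fun x _ => by rw [hm, div_eq_mul_inv]; ring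
  have e3 : ∑ x, cov h F φ x * v.ofLp x
      = (∑ x, (∑ σ, condLaw h φ σ * F σ * sv σ x) * v.ofLp x)
        - condMean h F φ * ∑ x, (∑ σ, condLaw h φ σ * sv σ x) * v.ofLp x := by
    unfold cov
    rw [mul_sum, ← sum_sub_distrib]
    exact sum_congr rfl fun x _ => by ring
  rw [e3, e1, e2, hGm, div_eq_mul_inv]
  have hDφ0 : Dφ ≠ 0 := hD0 φ
  field_simp
  ring

/-- `‖Σ_x Cov(F,σ_x) dφ_x‖ ≤ (Σ_x Cov(F,σ_x)²)^{1/2}`. [folklore] -/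
private theorem norm_covCLM_le (F : (Fin n → ℤˣ) → ℝ) (φ : EuclideanSpace ℝ (Fin n)) :
    ‖covCLM h F φ‖ ≤ Real.sqrt (∑ x, cov h F φ x ^ 2) :=
  ContinuousLinearMap.opNorm_le_bound _ (Real.sqrt_nonneg _) fun v => by
    rw [covCLM_apply, Real.norm_eq_abs]
    exact abs_sum_mul_le _ v

/-- Exercise 5 in the language of `μ_0^φ`: `Σ_x Cov_{μ_0^φ}(F,σ_x)² / (4E_{μ_0^φ}[F]) ≤ D_{μ_0^φ}(√F)`.
[cite: BauerschmidtBodineauDagallier2023, §6.4.3 Exercise 5] -/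
theorem sum_cov_sq_div_le {F : (Fin n → ℤˣ) → ℝ} (hF : ∀ σ, 0 ≤ F σ) (φ : EuclideanSpace ℝ (Fin n))
    (hG : 0 < condMean h F φ) :
    (∑ x, cov h F φ x ^ 2) / (4 * condMean h F φ)
      ≤ dirichletForm (condLaw h φ) flipKernel (fun σ => Real.sqrt (F σ)) := by
  have hκ : ∀ x, cov h F φ x = ∑ σ, tensorFun (siteLaw (φ.ofLp + h)) σ * F σ * sv σ x
      - (∑ σ, tensorFun (siteLaw (φ.ofLp + h)) σ * F σ)
        * (siteLaw (φ.ofLp + h) x 1 - siteLaw (φ.ofLp + h) x (-1)) := by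
    intro x
    unfold cov
    rw [sum_condLaw_mul_sv]
    rfl
  have hc : condLaw h φ = tensorFun (siteLaw (φ.ofLp + h)) := rfl
  have hGe : condMean h F φ = ∑ σ, tensorFun (siteLaw (φ.ofLp + h)) σ * F σ := rfl
  have hs : ∑ x, cov h F φ x ^ 2 = ∑ x, (∑ σ, tensorFun (siteLaw (φ.ofLp + h)) σ * F σ * sv σ x
      - (∑ σ, tensorFun (siteLaw (φ.ofLp + h)) σ * F σ)
        * (siteLaw (φ.ofLp + h) x 1 - siteLaw (φ.ofLp + h) x (-1))) ^ 2 :=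
    sum_congr rfl fun x _ => by rw [hκ]
  have key := sum_cov_spin_sq_div_le (pw := siteLaw (φ.ofLp + h)) (fun _ u => bw_pos _ u)
    (fun _ => sum_bw _) hF (by rw [hGe] at hG; exact hG)
  rw [hs, hGe, hc]
  exact key

/-- **The gradient bound** ([BBD] (e:Ising-secondterm) with Exercise 5): for `F ≥ 0` with `E_{μ_0^φ}[F] > 0`,
`|∇_φ (E_{μ_0^φ}[F])^{1/2}|² ≤ D_{μ_0^φ}(√F)` — since
`∇_{φ_x}(E_{μ_0^φ}[F])^{1/2} = Cov_{μ_0^φ}(F,σ_x)/(2(E_{μ_0^φ}[F])^{1/2})` and `Σ_x Cov² ≤ 4 E[F] D(√F)`.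
[cite: BauerschmidtBodineauDagallier2023, §6.4.3 (e:Ising-secondterm), Exercise 5] -/
theorem norm_fderiv_sqrt_condMean_sq_le {F : (Fin n → ℤˣ) → ℝ} (hF : ∀ σ, 0 ≤ F σ)
    (φ : EuclideanSpace ℝ (Fin n)) (hG : 0 < condMean h F φ) :
    ‖fderiv ℝ (fun ψ => Real.sqrt (condMean h F ψ)) φ‖ ^ 2
      ≤ dirichletForm (condLaw h φ) flipKernel (fun σ => Real.sqrt (F σ)) := by
  have hsq : HasFDerivAt (fun ψ => Real.sqrt (condMean h F ψ))
      ((1 / (2 * Real.sqrt (condMean h F φ))) • covCLM h F φ) φ :=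
    (hasFDerivAt_condMean F φ).sqrt hG.ne'
  rw [hsq.fderiv, norm_smul, Real.norm_eq_abs, abs_of_pos (by positivity), mul_pow]
  refine le_trans ?_ (sum_cov_sq_div_le hF φ hG)
  have h1 : ‖covCLM h F φ‖ ^ 2 ≤ ∑ x, cov h F φ x ^ 2 := by
    calc ‖covCLM h F φ‖ ^ 2 ≤ (Real.sqrt (∑ x, cov h F φ x ^ 2)) ^ 2 :=
          pow_le_pow_left₀ (norm_nonneg _) (norm_covCLM_le F φ) 2
      _ = ∑ x, cov h F φ x ^ 2 := Real.sq_sqrt (sum_nonneg fun x _ => sq_nonneg _)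
  have h2 : (1 / (2 * Real.sqrt (condMean h F φ))) ^ 2 = 1 / (4 * condMean h F φ) := by
    rw [div_pow, mul_pow, Real.sq_sqrt hG.le]; ring
  rw [h2]
  calc 1 / (4 * condMean h F φ) * ‖covCLM h F φ‖ ^ 2
      ≤ 1 / (4 * condMean h F φ) * ∑ x, cov h F φ x ^ 2 := mul_le_mul_of_nonneg_left h1 (by positivity)
    _ = (∑ x, cov h F φ x ^ 2) / (4 * condMean h F φ) := by ring

end Gradient

/-! ### The second term: Bakry–Émery for `ν` applied to `(E_{μ_0^φ}[F])^{1/2}` -/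

section SecondTerm

variable {A : Matrix (Fin n) (Fin n) ℝ} {h : Fin n → ℝ} {β c : ℝ}
variable (hA : A.PosSemidef) (hA1 : (1 - A).PosSemidef) (hβ : 0 ≤ β) (hβc : β < c) (hc1 : c < 1)
include hA hA1 hβ hβc hc1

/-- **Second term of (e:ent-decomp-Ising)**: for `F ≥ 0`, `F ≢ 0`,
`Ent_ν(E_{μ_0^φ}[F]) ≤ (2/λ) E_ν|∇(E_{μ_0^φ}[F])^{1/2}|² ≤ (2c/(1 − c)) E_ν[D_{μ_0^φ}(√F)]`, `λ = 1/c − 1`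
(Bakry–Émery for the uniformly log-concave `ν`, through the tree's `logSobolev_of_uniformlyConvex_of_bounded`,
then the gradient bound). [cite: BauerschmidtBodineauDagallier2023, §6.4.3 (e:Ising-secondterm), (e:lsiht-bis)] -/
theorem ent_fieldLaw_condMean_le {F : (Fin n → ℤˣ) → ℝ} (hF : ∀ σ, 0 ≤ F σ) (hF1 : ∃ σ, F σ ≠ 0) :
    (∫ φ, condMean h F φ * Real.log (condMean h F φ) ∂(fieldLaw (precM A β c) h))
        - (∫ φ, condMean h F φ ∂(fieldLaw (precM A β c) h))
          * Real.log (∫ φ, condMean h F φ ∂(fieldLaw (precM A β c) h))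
      ≤ 2 * c / (1 - c)
        * ∫ φ, dirichletForm (condLaw h φ) flipKernel (fun σ => Real.sqrt (F σ)) ∂(fieldLaw (precM A β c) h) := by
  haveI := isProbabilityMeasure_fieldLaw (h := h) hA hA1 hβ hβc
  have hc0 : 0 < c := hβ.trans_lt hβc
  have hlam : 0 < 1 / c - 1 := by rw [sub_pos, lt_div_iff₀ hc0]; linarith
  -- `G > 0`
  obtain ⟨σ₀, hσ₀⟩ := hF1
  have hF0 : 0 < F σ₀ := lt_of_le_of_ne (hF σ₀) (Ne.symm hσ₀)
  have hGpos : ∀ φ : EuclideanSpace ℝ (Fin n), 0 < condMean h F φ := fun φ => by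
    unfold condMean
    exact lt_of_lt_of_le (mul_pos (condLaw_pos h φ σ₀) hF0)
      (single_le_sum (f := fun σ => condLaw h φ σ * F σ)
        (fun σ _ => mul_nonneg (condLaw_pos h φ σ).le (hF σ)) (mem_univ σ₀))
  -- the test function `f = √G`
  set f : EuclideanSpace ℝ (Fin n) → ℝ := fun φ => Real.sqrt (condMean h F φ) with hfdef
  have hf : ContDiff ℝ 1 f := contDiff_sqrt_condMean F fun φ => (hGpos φ).ne'
  have hB : ∀ φ, |f φ| ≤ Real.sqrt (∑ σ, |F σ|) := fun φ => by
    rw [hfdef, abs_of_nonneg (Real.sqrt_nonneg _)]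
    exact Real.sqrt_le_sqrt ((le_abs_self _).trans (abs_sum_condLaw_mul_le F φ))
  set L2 : ℝ := (1 / 2) * ∑ σ : Fin n → ℤˣ, ∑ x, (Real.sqrt (F σ) - Real.sqrt (F (flip x σ))) ^ 2 with hL2
  have hDle : ∀ φ, dirichletForm (condLaw h φ) flipKernel (fun σ => Real.sqrt (F σ)) ≤ L2 := fun φ => by
    rw [dirichletForm_flipKernel, hL2]
    refine mul_le_mul_of_nonneg_left (sum_le_sum fun σ _ => ?_) (by norm_num)
    exact (mul_le_of_le_one_left (sum_nonneg fun x _ => sq_nonneg _) (condLaw_le_one φ σ))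
  have hL : ∀ φ, ‖fderiv ℝ f φ‖ ≤ Real.sqrt L2 := fun φ => by
    rw [← Real.sqrt_sq (norm_nonneg _)]
    exact Real.sqrt_le_sqrt ((norm_fderiv_sqrt_condMean_sq_le hF φ (hGpos φ)).trans (hDle φ))
  -- Bakry–Émery
  have hZ : Integrable fun φ : EuclideanSpace ℝ (Fin n) => Real.exp (-fieldPot (precM A β c) h φ) := by
    simp_rw [exp_neg_fieldPot]
    exact integrable_fieldDens hA hA1 hβ hβc
  have hLS := Literature.Analysis.FunctionSpaces.logSobolev_of_uniformlyConvex_of_bounded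
    (V := fieldPot (precM A β c) h) (G := gradPot (precM A β c) h) (lam := 1 / c - 1) hlam
    continuous_fieldPot
    (fun x y => fieldPot_uniformlyConvex (h := h) (precM_transpose hA) (dot_precM_ge hA hA1 hβ hβc) x y)
    hZ hf hB hL
  -- `f² = G`
  have hf2 : ∀ φ, f φ ^ 2 = condMean h F φ := fun φ => by rw [hfdef]; exact Real.sq_sqrt (hGpos φ).le
  simp_rw [hf2] at hLS
  change (∫ φ, condMean h F φ * Real.log (condMean h F φ) ∂(fieldLaw (precM A β c) h))
      - (∫ φ, condMean h F φ ∂(fieldLaw (precM A β c) h))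
        * Real.log (∫ φ, condMean h F φ ∂(fieldLaw (precM A β c) h))
    ≤ 2 / (1 / c - 1) * ∫ φ, ‖fderiv ℝ f φ‖ ^ 2 ∂(fieldLaw (precM A β c) h) at hLS
  refine hLS.trans ?_
  have e : 2 / (1 / c - 1) = 2 * c / (1 - c) := by
    have : 1 - c ≠ 0 := by linarith
    field_simp
  rw [e]
  refine mul_le_mul_of_nonneg_left ?_ (div_nonneg (by linarith) (by linarith))
  refine integral_mono ?_ (integrable_dirichletForm_condLaw _) fun φ =>
    norm_fderiv_sqrt_condMean_sq_le hF φ (hGpos φ)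
  exact integrable_fieldLaw_of_bounded ((hf.continuous_fderiv one_ne_zero).norm.pow 2) L2 fun φ => by
    rw [abs_of_nonneg (sq_nonneg _), ← Real.sq_sqrt (show 0 ≤ L2 from ?_)]
    · exact pow_le_pow_left₀ (norm_nonneg _) (hL φ) 2
    · rw [hL2]; positivity

/-- **(e:Ising-summary1) at fixed `c = α ∈ (β,1)`**: `Ent_μ(F) ≤ (1 + 2c/(1 − c)) D_μ(√F)` for `Λ = Fin n`.
[cite: BauerschmidtBodineauDagallier2023, §6.4.3 (e:Ising-summary1)] -/
theorem ent_law_le_of_lt (F : (Fin n → ℤˣ) → ℝ) (hF : ∀ σ, 0 ≤ F σ) :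
    ent (law A h β) F ≤ (1 + 2 * c / (1 - c)) * dirichletForm (law A h β) flipKernel (fun σ => Real.sqrt (F σ)) := by
  haveI := isProbabilityMeasure_fieldLaw (h := h) hA hA1 hβ hβc
  by_cases hF0 : ∀ σ, F σ = 0
  · -- `F ≡ 0`: both sides vanish
    have e1 : ent (law A h β) F = 0 := by
      unfold ent; simp [hF0]
    have e2 : dirichletForm (law A h β) flipKernel (fun σ => Real.sqrt (F σ)) = 0 := by
      unfold dirichletForm; simp [hF0]
    rw [e1, e2, mul_zero]
  · obtain ⟨σ₀, hσ₀⟩ := not_forall.1 hF0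
    rw [ent_law_eq hA hA1 hβ hβc F, dirichletForm_law_eq_integral hA hA1 hβ hβc, add_mul, one_mul]
    exact add_le_add (integral_ent_condLaw_le hF) (ent_fieldLaw_condMean_le hA hA1 hβ hβc hc1 hF ⟨σ₀, hσ₀⟩)

end SecondTerm

/-! ## §8 Theorem 10 for `Λ = Fin n` (the limit `α ↓ β`) -/

section Assembly

/-- **[BBD] Theorem 10 on `Λ = Fin n`**: `Ent_μ(F) ≤ (1 + 2β/(1 − β)) D_μ(√F)` for `0 ≤ A ≤ 1`, `0 < β < 1`,
every field `h` and every `F ≥ 0` ("Taking `α ↓ β`, this leads to the following theorem").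
[cite: BauerschmidtBodineauDagallier2023, Theorem 10] -/
theorem ent_law_le_fin {A : Matrix (Fin n) (Fin n) ℝ} (hA : A.PosSemidef) (hA1 : (1 - A).PosSemidef)
    (h : Fin n → ℝ) {β : ℝ} (hβ0 : 0 < β) (hβ1 : β < 1) (F : (Fin n → ℤˣ) → ℝ) (hF : ∀ σ, 0 ≤ F σ) :
    ent (law A h β) F ≤ (1 + 2 * β / (1 - β)) * dirichletForm (law A h β) flipKernel (fun σ => Real.sqrt (F σ)) := by
  set D := dirichletForm (law A h β) flipKernel (fun σ => Real.sqrt (F σ)) with hD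
  have hK : ContinuousAt (fun c : ℝ => (1 + 2 * c / (1 - c)) * D) β := by
    have h1 : ContinuousAt (fun c : ℝ => 1 - c) β := (continuousAt_const.sub continuousAt_id)
    have h2 : (fun c : ℝ => 1 - c) β ≠ 0 := by simp only; linarith
    exact ((continuousAt_const.add ((continuousAt_const.mul continuousAt_id).div h1 h2)).mul
      continuousAt_const)
  refine ge_of_tendsto (x := nhdsWithin β (Set.Ioi β)) (hK.tendsto.mono_left nhdsWithin_le_nhds) ?_
  filter_upwards [Ioo_mem_nhdsGT hβ1] with c hc
  exact ent_law_le_of_lt hA hA1 hβ0.le hc.1 hc.2 F hF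

end Assembly

/-! ## §9 Relabelling the sites: Theorem 10 for every finite `Λ` -/

section Reindex

variable {Λ : Type} [Fintype Λ] [DecidableEq Λ] (e : Λ ≃ Fin n)

/-- Relabelling of configurations `σ ↦ σ ∘ e⁻¹`. [folklore] -/
private def R (e : Λ ≃ Fin n) : (Λ → ℤˣ) ≃ (Fin n → ℤˣ) := e.arrowCongr (Equiv.refl ℤˣ)

omit [Fintype Λ] [DecidableEq Λ] in
/-- `(σ ∘ e⁻¹)_i = σ_{e⁻¹ i}`. [folklore] -/
private theorem R_apply (σ : Λ → ℤˣ) (i : Fin n) : R e σ i = σ (e.symm i) := rfl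

omit [Fintype Λ] in
/-- Relabelling commutes with spin flips: `(σ^x) ∘ e⁻¹ = (σ ∘ e⁻¹)^{e x}`. [folklore] -/
private theorem R_flip (σ : Λ → ℤˣ) (x : Λ) : R e (flip x σ) = flip (e x) (R e σ) := by
  funext i
  simp only [R_apply, flip_apply]
  by_cases hi : i = e x
  · subst hi; simp
  · have : e.symm i ≠ x := fun hx => hi (by rw [← hx, Equiv.apply_symm_apply])
    simp [hi, this]

omit [DecidableEq Λ] in
/-- The relabelled Boltzmann weight. [folklore] -/
private theorem weight_reindex (A : Matrix Λ Λ ℝ) (h : Λ → ℝ) (β : ℝ) (σ : Λ → ℤˣ) :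
    weight (A.submatrix e.symm e.symm) (h ∘ e.symm) β (R e σ) = weight A h β σ := by
  unfold weight spin
  simp only [submatrix_apply, Function.comp_apply, R_apply]
  have s1 : ∑ i, ∑ j, ((σ (e.symm i) : ℤ) : ℝ) * A (e.symm i) (e.symm j) * ((σ (e.symm j) : ℤ) : ℝ)
      = ∑ x, ∑ y, ((σ x : ℤ) : ℝ) * A x y * ((σ y : ℤ) : ℝ) :=
    Fintype.sum_equiv e.symm _ _ fun i => Fintype.sum_equiv e.symm _ _ fun j => rfl
  have s2 : ∑ i, h (e.symm i) * ((σ (e.symm i) : ℤ) : ℝ) = ∑ x, h x * ((σ x : ℤ) : ℝ) :=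
    Fintype.sum_equiv e.symm _ _ fun i => rfl
  rw [s1, s2]

/-- The relabelled partition function. [folklore] -/
private theorem Z_reindex (A : Matrix Λ Λ ℝ) (h : Λ → ℝ) (β : ℝ) :
    Z (A.submatrix e.symm e.symm) (h ∘ e.symm) β = Z A h β := by
  unfold Z
  rw [← Equiv.sum_comp (R e)]
  exact sum_congr rfl fun σ _ => weight_reindex e A h β σ

/-- The relabelled Ising law. [folklore] -/
private theorem law_reindex (A : Matrix Λ Λ ℝ) (h : Λ → ℝ) (β : ℝ) (σ : Λ → ℤˣ) :
    law (A.submatrix e.symm e.symm) (h ∘ e.symm) β (R e σ) = law A h β σ := by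
  unfold law
  rw [weight_reindex, Z_reindex]

/-- Entropy is invariant under relabelling. [folklore] -/
private theorem ent_reindex (A : Matrix Λ Λ ℝ) (h : Λ → ℝ) (β : ℝ) (F : (Λ → ℤˣ) → ℝ) :
    ent (law (A.submatrix e.symm e.symm) (h ∘ e.symm) β) (fun τ => F (τ ∘ e)) = ent (law A h β) F := by
  unfold ent
  have hc : ∀ σ : Λ → ℤˣ, (R e σ) ∘ e = σ := fun σ => by
    funext x; simp [Function.comp_apply, R_apply]
  rw [← Equiv.sum_comp (R e) (fun τ => law _ _ β τ * (F (τ ∘ e) * Real.log (F (τ ∘ e)))),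
    ← Equiv.sum_comp (R e) (fun τ => law _ _ β τ * F (τ ∘ e))]
  simp_rw [hc, law_reindex]

/-- The standard Dirichlet form is invariant under relabelling. [folklore] -/
private theorem dirichletForm_reindex (A : Matrix Λ Λ ℝ) (h : Λ → ℝ) (β : ℝ) (g : (Λ → ℤˣ) → ℝ) :
    dirichletForm (law (A.submatrix e.symm e.symm) (h ∘ e.symm) β) flipKernel (fun τ => g (τ ∘ e))
      = dirichletForm (law A h β) flipKernel g := by
  rw [dirichletForm_flipKernel, dirichletForm_flipKernel]
  have hc : ∀ σ : Λ → ℤˣ, (R e σ) ∘ e = σ := fun σ => by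
    funext x; simp [Function.comp_apply, R_apply]
  rw [← Equiv.sum_comp (R e)]
  congr 1
  refine sum_congr rfl fun σ _ => ?_
  rw [law_reindex, hc]
  congr 1
  rw [← Equiv.sum_comp e]
  refine sum_congr rfl fun x _ => ?_
  rw [← R_flip, hc]

omit [Fintype Λ] in
/-- `0 ≤ A ≤ 1` is preserved under relabelling. [folklore] -/
private theorem posSemidef_reindex {A : Matrix Λ Λ ℝ} (hA : A.PosSemidef) (hA1 : (1 - A).PosSemidef) :
    (A.submatrix e.symm e.symm).PosSemidef ∧ (1 - A.submatrix e.symm e.symm).PosSemidef := by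
  refine ⟨hA.submatrix e.symm, ?_⟩
  have : (1 : Matrix (Fin n) (Fin n) ℝ) - A.submatrix e.symm e.symm = (1 - A).submatrix e.symm e.symm := by
    ext i j
    simp [Matrix.one_apply, submatrix_apply]
  rw [this]
  exact hA1.submatrix e.symm

end Reindex

end HS

/-- **DISCHARGE of the named fact `BauerschmidtBodineau2019_logSobolev` ([BBD] Theorem 10 = Bauerschmidt–Bodineau
2019): the spectral high-temperature log-Sobolev inequality** — for every finite `Λ`, every real symmetric
`A` with spectrum in `[0,1]`, every field `h` and every `0 < β < 1`, the Ising model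
`μ(σ) ∝ e^{−½β(σ,Aσ) + (h,σ)}` satisfies `Ent_μ(F) ≤ (1 + 2β/(1 − β)) D_μ(√F)` for all `F ≥ 0`.  Proof =
[BBD] §6.4.1–6.4.3 (Hubbard–Stratonovich decomposition, product LSI with `γ₀ = 2`, Bakry–Émery for the
renormalised measure, Exercise 5, `α ↓ β`) on `Fin |Λ|` (`HS.ent_law_le_fin`), transported along
`Λ ≃ Fin |Λ|`. [cite: BauerschmidtBodineauDagallier2023, Theorem 10] [cite: BauerschmidtBodineau2019] -/
theorem BauerschmidtBodineau2019_logSobolev_holds : BauerschmidtBodineau2019_logSobolev := by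
  intro Λ _ _ A h β hA hA1 hβ0 hβ1 F hF
  set e : Λ ≃ Fin (Fintype.card Λ) := Fintype.equivFin Λ
  obtain ⟨hA', hA1'⟩ := HS.posSemidef_reindex e hA hA1
  have key := HS.ent_law_le_fin hA' hA1' (h ∘ e.symm) hβ0 hβ1 (fun τ => F (τ ∘ e)) (fun τ => hF _)
  rw [HS.ent_reindex, HS.dirichletForm_reindex e A h β (fun σ => Real.sqrt (F σ))] at key
  exact key

end SpectralIsing

end Literature.Probability.MarkovChains
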